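import Literature.Computability.FineGrained.CliqueETHGroupingReduction
import Literature.Computability.FineGrained.DomSetSETHGraph
import HarnessLib

/-!
# SETH-hardness of `k`-Dominating Set: the word-RAM program of the Pătraşcu–Williams reduction

The program behind the discharge of the named fact
`Literature.Computability.FineGrained.not_sethWordRAM_of_kDominatingSet_inTimeO`
(**fine-grained.S18**; Pătraşcu–Williams, *On the possibility of faster SAT algorithms*, SODA 2010,
§2, Thm. 2.1 / Lemma 2.1, p. 1068: an `O(N^{k-ε})` algorithm for `k`-Dominating Set decides CNF-SAT
on `n` variables and `m` clauses in time `(m + k 2^{n/k})^{k-ε} · poly(m)`), written — exactly like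
the grouping reduction of `…CliqueETHReductionProgram` / `…CliqueETHGroupingReduction`, whose generic
pieces (`CliqueRed.sizeLoop`, `CliqueRed.setup3`, `CliqueRed.clearRegs`, `CliqueRed.post`, the
layout `CliqueRed.lay` and their lemmas) are reused — as structured word-RAM code (`SProg`) around
one emulated run of the hypothetical dominating-set program (`SProg.withSubrun`), its verification,
the run, the word size and the time analysis. The theorem they serve,
`kSATInRAMTime_of_kDominatingSet_inTimeO` and the discharge
`not_sethWordRAM_of_kDominatingSet_inTimeO_holds`, are in `…SETHHardnessProofs` (they need the
clause count `numClauses_le_of_nodup` proved there).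

* **The program** (`DomSetRed.pre K kM cM`, `DomSetRed.reduction`): relocate the input
  (`SProg.relocate`); compute `n, m, B = ⌈n/K⌉, S = 2^B, K S, N = K S + m + K`, the base `Bv` of
  the emulated cells (`setup1`), the emulated word size `ws = kM · size (N² + 1)` (`sizeLoop`) and
  the emulator's environment (`setup3`); write the rows `a < K S` of the adjacency matrix of the
  Pătraşcu–Williams graph (`pwAdj` of `…DomSetSETHGraph`), reduced modulo `2^ws`, into the emulated
  cells (`matrix`: per row the group columns `grpEntry`, the clause columns `clauseEntry` — one pass
  over the literals of the clause, `litBody`, disjunctions computed with the overflow-free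
  `eq`/`band`/`lt` — and the dummy columns `dumEntry`; the rows `a ≥ K S` are zero and are never
  written); the header `N² + 1, N` (`header`); clear the scratch (`clearRegs`); after the emulated
  run, `post` copies the answer bit to the output.
* **Ghost parameters** (`DomSetRed.Params`: `x, Lx, X, n, m, B, S, KS, N, Bv, ws, Pw, V, Sv, env`),
  the word-size requirement `Params.Fits W`, the intended data stage by stage (`adjVal`, `ycell`;
  `matData`, `finData`, `finMem`) and the register conventions `Regs`, `ERegs`, `RowRegs` and the
  loop invariants `GrpInv`, `ClInv`, `LitInv`, `DumInv`, `RowInv`.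
* **Verification** by symbolic execution of straight-line blocks and the counted while rule,
  innermost loop first: `setup1_spec`, `setup3_spec` (the size loop is
  `CliqueRed.Params.sizeLoop_spec`), `grpEntry_spec`, `litBody_spec` (`satUpTo`, literal by
  literal, ends in `satB`: `satUpTo_length`), `clauseEntry_spec`, `dumEntry_spec`, `rowBody_spec`,
  `matrix_spec`, `finData_header`, and **`Params.pre_spec`**: on the initial memory of
  `x = encodeCNFWords φ` (word size `W` with `Fits W`, `K ≥ 1`, width `≤ k`) the build ends within
  `Params.Tpre k` steps in exactly the memory `Params.finMem`.
* **The run** (`Params.reduction_outputsWithin`, via `SProg.outputsWithin_withSubrun`: `envOK`,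
  `tinv_finMem`, `agree_finMem`, `post_spec`): the reduction program outputs the dominating-set
  program's answer bit — `[1]` iff `φ` is satisfiable, by `hasDominatingSetOfCard_pwMatrix_iff` —
  within `Tpre + 38 T + 4` steps; **the word size** (`Params.kfit`, `Params.fits`); **the time**
  (`Params.Tpre_le`: the build is linear in `Lx + N²`; `Params.N_real_le`: `N ≤ (3K + m) 2^{n/K}`;
  `Params.N_rpow_le`, `Params.N_sq_le`: `N^{K-ε}, N² ≤ (3K+m)^K 2^{(1-ε/K) n}` for `0 < ε ≤ 1`,
  `K ≥ 3`; `Params.Q_pow_le`: `(3K+m)^K` is polynomial in `n` when `m ≤ (2(n+1))^{k+1}`).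

## References

* M. Pătraşcu, R. Williams, *On the possibility of faster SAT algorithms*, Proc. SODA 2010,
  1065–1075, §2: Hypothesis 1, Thm. 2.1, Lemma 2.1 (p. 1068).
* V. Vassilevska Williams, *On some fine-grained questions in algorithms and complexity*,
  Proc. ICM 2018, §2 (the word RAM; algorithms calling an algorithm for another problem).
* T. Nipkow, G. Klein, *Concrete Semantics with Isabelle/HOL*, Springer 2014, §12 (verification
  of `WHILE` programs by invariants).
-/

namespace Literature.Computability.FineGrained

open Cryptography Cryptography.WordRAM Complexity Cryptography.WordRAM.SProg

namespace DomSetRed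

-- Operand shorthands `r i = .dir i`, `pt i = .ind i`, `im c = .imm c` of the clique build.
open CliqueRed (r pt im)

/-! ### Register map

`0 = X` (base of the relocated input, `x[j]` in cell `X + j`), `1 = X - 1` (set by `relocate`);
`2 = n`, `3 = m`, `4 = B`, `5 = S = 2^B`, `6 = N`, `7 = K S`, `8 = K`; the emulator's layout
(`CliqueRed.lay`) `10 = Bv`, `11 = Sv`, `12 = Gv (= 0)`, `13 = Pw = 2^ws`, temporaries `14–16`;
`17` post; scratch `20–27` (setup), `30–45` (the matrix: `30 = a`, `31 = K S - a`, `32 = a / S`,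
`33 = a % S`, `34` = write pointer, `35` = column count-down, `36` = column, `37` = value,
`38` = clause pointer, `39` = literal count-down, `40` = satisfaction bit, `41–45` literal scratch). -/

/-! ### Setup: the constants -/

/-- Setup, part 1: `n, m, B, S, K S, N, K, Bv`, then `r21 := N² + 1`, `r22 := 0`. [folklore] -/
def setup1 (K : ℕ) : SProg := block [
  (.band, r 2, pt 0, pt 0),
  (.add, r 20, r 0, im 1), (.band, r 3, pt 20, pt 20),
  (.add, r 4, r 2, im (K - 1)), (.div, r 4, r 4, im K),
  (.shl, r 5, im 1, r 4),
  (.mul, r 7, im K, r 5),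
  (.add, r 6, r 7, r 3), (.add, r 6, r 6, im K),
  (.band, r 8, im K, im K),
  (.sub, r 20, r 1, im 100), (.add, r 10, r 1, r 20), (.add, r 10, r 10, im 1),
  (.mul, r 21, r 6, r 6), (.add, r 21, r 21, im 1), (.band, r 22, im 0, im 0)]

/-! ### The adjacency matrix -/

/-- Group columns, one entry `a' = r36` of row `a` (`i = r32`): the bit `a' / S = i`, reduced
modulo `Pw`, at the write pointer; advance. [folklore] -/
def grpEntry : SProg := block [
  (.div, r 37, r 36, r 5), (.eq, r 37, r 37, r 32), (.mod, r 37, r 37, r 13),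
  (.band, pt 34, r 37, r 37), (.add, r 34, r 34, im 1), (.add, r 36, r 36, im 1),
  (.sub, r 35, r 35, im 1)]

/-- Clause columns, one literal (code at `r38`): OR into `r40` the bit "the literal's variable lies
in group `i = r32` and the mask `μ = r33` gives it its polarity" (disjunction by `eq`/`band`/`lt`).
[folklore] -/
def litBody : SProg := block [
  (.band, r 41, pt 38, pt 38),
  (.shr, r 42, r 41, im 1), (.band, r 43, r 41, im 1),
  (.div, r 44, r 42, r 4), (.eq, r 44, r 44, r 32),
  (.mod, r 45, r 42, r 4), (.shr, r 45, r 33, r 45), (.band, r 45, r 45, im 1), (.eq, r 45, r 45, r 43),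
  (.band, r 44, r 44, r 45),
  (.eq, r 45, r 40, im 0), (.eq, r 44, r 44, im 0), (.band, r 44, r 45, r 44), (.lt, r 40, r 44, im 1),
  (.add, r 38, r 38, im 1), (.sub, r 39, r 39, im 1)]

/-- Clause columns, one clause (block at `r38`): read its length, scan its literals, write the
satisfaction bit, reduced modulo `Pw`, at the write pointer; advance. [folklore] -/
def clauseEntry : SProg := seqs [
  block [(.band, r 39, pt 38, pt 38), (.add, r 38, r 38, im 1), (.band, r 40, im 0, im 0)],
  whilenz (r 39) litBody,
  block [(.mod, r 40, r 40, r 13), (.band, pt 34, r 40, r 40), (.add, r 34, r 34, im 1),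
    (.sub, r 35, r 35, im 1)]]

/-- Dummy columns, one entry `i' = r36`: the bit `i' = i`, reduced modulo `Pw`; advance.
[folklore] -/
def dumEntry : SProg := block [
  (.eq, r 37, r 36, r 32), (.mod, r 37, r 37, r 13),
  (.band, pt 34, r 37, r 37), (.add, r 34, r 34, im 1), (.add, r 36, r 36, im 1),
  (.sub, r 35, r 35, im 1)]

/-- One row `a = r30` of the adjacency matrix (`a < K S`): the group columns, the clause columns,
the dummy columns, in this order, into the emulated cells `2 + a N, …`. [folklore] -/
def rowBody : SProg := seqs [
  block [(.div, r 32, r 30, r 5), (.mod, r 33, r 30, r 5),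
    (.mul, r 34, r 30, r 6), (.add, r 34, r 34, r 10), (.add, r 34, r 34, im 2),
    (.band, r 35, r 7, r 7), (.band, r 36, im 0, im 0)],
  whilenz (r 35) grpEntry,
  block [(.band, r 35, r 3, r 3), (.add, r 38, r 0, im 2)],
  whilenz (r 35) clauseEntry,
  block [(.band, r 35, r 8, r 8), (.band, r 36, im 0, im 0)],
  whilenz (r 35) dumEntry,
  block [(.add, r 30, r 30, im 1), (.sub, r 31, r 31, im 1)]]

/-- The rows `a < K S` of the adjacency matrix of the Pătraşcu–Williams graph, in the emulated
memory (the remaining rows are zero). [folklore] -/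
def matrix : SProg := seqs [
  block [(.band, r 30, im 0, im 0), (.band, r 31, r 7, r 7)],
  whilenz (r 31) rowBody]

/-! ### Header, build, read-out -/

/-- The header of the emulated input: cells `0, 1` hold `N² + 1`, `N` (mod `Pw`). [folklore] -/
def header : SProg := block [
  (.mul, r 20, r 6, r 6), (.add, r 20, r 20, im 1), (.mod, r 20, r 20, r 13),
  (.band, pt 10, r 20, r 20),
  (.mod, r 20, r 6, r 13), (.add, r 21, r 10, im 1), (.band, pt 21, r 20, r 20)]

/-- **The build**: relocate the input, compute the constants and the emulator's environment
(`CliqueRed.sizeLoop`, `CliqueRed.setup3`), the adjacency matrix and the header of the emulated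
`kDominatingSet K` input, clear the scratch (`CliqueRed.clearRegs`). (`K` groups; `kM`, `cM`:
word-size constant and largest constant of the dominating-set program.) [folklore] -/
def pre (K kM cM : ℕ) : SProg := seqs [
  relocate, setup1 K, CliqueRed.sizeLoop, CliqueRed.setup3 kM cM, matrix, header, CliqueRed.clearRegs]

/-- **The reduction program**: CNF-SAT by one emulated run of the dominating-set program `M`
(layout `CliqueRed.lay`, read-out `CliqueRed.post`). [folklore] -/
def reduction (M : Program) (K kM : ℕ) : Program :=
  withSubrun (pre K kM M.maxConst) CliqueRed.lay M CliqueRed.post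

/-- The build is query-free. [folklore] -/
theorem pre_queryFree (K kM cM : ℕ) : (pre K kM cM).QueryFree := by
  refine seqs_queryFree ?_
  simp only [List.mem_cons, List.not_mem_nil, or_false]
  rintro s (rfl | rfl | rfl | rfl | rfl | rfl | rfl)
  · exact relocate_queryFree
  · exact block_queryFree _
  · exact block_queryFree _
  · refine seqs_queryFree ?_
    simp only [List.mem_cons, List.not_mem_nil, or_false]
    rintro s (rfl | rfl | rfl | rfl | rfl)
    · exact block_queryFree _
    · exact ⟨trivial, block_queryFree _⟩
    · exact block_queryFree _
    · exact ⟨trivial, block_queryFree _⟩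
    · exact block_queryFree _
  · simp [matrix, rowBody, grpEntry, clauseEntry, litBody, dumEntry, seqs, QueryFree,
      block_queryFree]
  · exact block_queryFree _
  · exact block_queryFree _

/-- The reduction program is deterministic. [folklore] -/
theorem reduction_isDeterministic (M : Program) (K kM : ℕ) : (reduction M K kM).IsDeterministic :=
  withSubrun_isDeterministic _ _ _ _

/-- The reduction program is oracle-free. [folklore] -/
theorem reduction_isOracleFree (M : Program) (K kM : ℕ) : (reduction M K kM).IsOracleFree :=
  withSubrun_isOracleFree (pre_queryFree _ _ _) CliqueRed.post_queryFree _ _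

/-! ### Ghost parameters of a run -/

/-- The data of a run of the reduction: the formula, the number of groups `K`, and the word-size
constant `kM` and largest constant `cM` of the dominating-set program. [folklore] -/
structure Params where
  /-- The input formula. -/
  φ : CNF ℕ
  /-- The number of groups (= the size of the dominating set sought). -/
  K : ℕ
  /-- The word-size constant of the dominating-set program. -/
  kM : ℕ
  /-- The largest constant of the dominating-set program. -/
  cM : ℕ

namespace Params

variable (g : Params)

/-- The input words. [folklore] -/
def x : List ℕ := encodeCNFWords g.φ
/-- The input length `Lx`. [folklore] -/
def Lx : ℕ := g.x.length
/-- The base `X` of the relocated input: `x[j]` sits in cell `X + j`. [folklore] -/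
def X : ℕ := g.Lx + 101
/-- The number of variables. [folklore] -/
def n : ℕ := g.φ.numVars
/-- The number of clauses. [folklore] -/
def m : ℕ := g.φ.length
/-- The group length `B = ⌈n / K⌉`. [folklore] -/
def B : ℕ := blockLen g.n g.K
/-- Masks (partial assignments) per group, `S = 2^B`. [folklore] -/
def S : ℕ := 2 ^ g.B
/-- The number of partial-assignment vertices `K S`. [folklore] -/
def KS : ℕ := g.K * g.S
/-- The number of vertices `N = K S + m + K`. [folklore] -/
def N : ℕ := g.KS + g.m + g.K
/-- Base of the emulated cells (right after the relocated input). [folklore] -/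
def Bv : ℕ := g.X + g.Lx
/-- The emulated word size `ws = kM · size (N² + 1)`. [folklore] -/
def ws : ℕ := g.kM * Nat.size (g.N * g.N + 1)
/-- The emulated modulus `Pw = 2^ws`. [folklore] -/
def Pw : ℕ := 2 ^ g.ws
/-- The value bound `V = max (Pw - 1) (max cM (N² + 2))` of the emulation. [folklore] -/
def V : ℕ := max (g.Pw - 1) (max g.cM (g.N * g.N + 2))
/-- Base of the stamps. [folklore] -/
def Sv : ℕ := g.Bv + g.V + 1
/-- The emulator environment: cells at `Bv`, stamps at `Sv`, generation `0`, word size `ws`,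
region size `V + 1`. [folklore] -/
def env : Env := ⟨g.Bv, g.Sv, 0, g.ws, g.V + 1⟩

/-- The chain of bases. [folklore] -/
theorem bases : 100 < g.X ∧ g.X + g.Lx = g.Bv ∧ g.Bv + g.V + 1 = g.Sv := by
  refine ⟨by unfold X; omega, rfl, rfl⟩

/-- `2 ≤ Lx`: the encoding starts with `numVars, numClauses`. [folklore] -/
theorem two_le_Lx : 2 ≤ g.Lx := by
  unfold Lx x; rw [length_encodeCNFWords_eq]; omega

/-- `1 ≤ S`. [folklore] -/
theorem one_le_S : 1 ≤ g.S := Nat.one_le_two_pow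

/-- `N² + 2 ≤ V`, `cM ≤ V`, `Pw - 1 ≤ V`. [folklore] -/
theorem le_V : g.N * g.N + 2 ≤ g.V ∧ g.cM ≤ g.V ∧ g.Pw - 1 ≤ g.V :=
  ⟨le_max_of_le_right (le_max_right _ _), le_max_of_le_right (le_max_left _ _), le_max_left _ _⟩

/-- The vertex number is that of the Pătraşcu–Williams instance. [folklore] -/
theorem N_eq : g.N = pwN g.φ g.K := rfl

/-- **Word-size requirements** of a run at word size `W`: the stamps fit (`Sv + V + 1 ≤ 2 ^ W`,
whence every address and every table value fits), the emulated word size is below `W`, the input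
width is at most `W` (so the input is stored exactly), and `n + K` fits (the setup computes
`n + K - 1`). [folklore] -/
structure Fits (W : ℕ) : Prop where
  top : g.Sv + g.V + 1 ≤ 2 ^ W
  ws_lt : g.ws < W
  width : inputWidth g.x ≤ W
  nK : g.n + g.K < 2 ^ W

/-- Under `Fits`, the input words fit. [folklore] -/
theorem Fits.input {g : Params} {W : ℕ} (h : g.Fits W) : ∀ v ∈ g.x, v < 2 ^ W := fun v hv =>
  lt_of_lt_of_le (lt_two_pow_inputWidth_of_mem g.x v hv) (Nat.pow_le_pow_right Nat.two_pos h.width)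

/-! ### The intended data, stage by stage -/

/-- The adjacency bit of `(a, c)`, reduced modulo the emulated modulus. [folklore] -/
def adjVal (a c : ℕ) : ℕ :=
  (pwAdj g.φ g.B g.K g.S g.m a c).toNat % g.Pw

/-- The emulated input: the `kDominatingSet K` encoding of the Pătraşcu–Williams instance.
[folklore] -/
noncomputable def y : List ℕ := (kDominatingSet g.K).encode (pwInstance g.φ g.K)

/-- Emulated cell `j` of the initial memory of the dominating-set program on `y` (word size `ws`):
`|y| = N² + 1` in cell `0`, `y[j - 1]` in cell `j`, reduced modulo `Pw`, and `0` past the input.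
[folklore] -/
noncomputable def ycell (j : ℕ) : ℕ :=
  if j = 0 then (g.N * g.N + 1) % g.Pw else (g.y.getD (j - 1) 0) % g.Pw

/-- Data after `q` entries of the matrix (row-major, from emulated cell `2`) have been written:
below `Bv` the relocated input, then the two (still empty) header cells, then the entries.
[folklore] -/
def matData (q a : ℕ) : ℕ :=
  if a < g.Bv then relocated g.x a
  else if a < g.Bv + 2 then 0
  else if a - (g.Bv + 2) < q then g.adjVal ((a - (g.Bv + 2)) / g.N) ((a - (g.Bv + 2)) % g.N)
  else 0

/-- The final data: the relocated input and the emulated input `y` (header and matrix).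
[folklore] -/
noncomputable def finData (a : ℕ) : ℕ :=
  if a < g.Bv then relocated g.x a
  else if a < g.Bv + (g.N * g.N + 2) then g.ycell (a - g.Bv)
  else 0

/-- **The final memory of the build**: registers `10–13` hold `Bv, Sv, 0, Pw`, every other
register is `0`, and the data is `finData`. [folklore] -/
noncomputable def finMem (a : ℕ) : ℕ :=
  if a < 100 then (if a = 10 then g.Bv else if a = 11 then g.Sv else if a = 13 then g.Pw else 0)
  else g.finData a

/-! ### Register conventions -/

/-- The registers after the setup: `X, n, m, B, S, N, K S, K, Bv`. [folklore] -/
structure Regs (m : ℕ → ℕ) : Prop where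
  r0 : m 0 = g.X
  r2 : m 2 = g.n
  r3 : m 3 = g.m
  r4 : m 4 = g.B
  r5 : m 5 = g.S
  r6 : m 6 = g.N
  r7 : m 7 = g.KS
  r8 : m 8 = g.K
  r10 : m 10 = g.Bv

/-- The environment registers: `Sv, Gv = 0, Pw`. [folklore] -/
structure ERegs (m : ℕ → ℕ) : Prop where
  r11 : m 11 = g.Sv
  r12 : m 12 = 0
  r13 : m 13 = g.Pw

variable {g}

/-- `Regs` survives changes above register `10`. [folklore] -/
theorem Regs.of_frame {m m' : ℕ → ℕ} (h : g.Regs m) (hf : ∀ a, a ≤ 10 → m' a = m a) : g.Regs m' :=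
  ⟨(hf 0 (by omega)).trans h.r0, (hf 2 (by omega)).trans h.r2, (hf 3 (by omega)).trans h.r3,
    (hf 4 (by omega)).trans h.r4, (hf 5 (by omega)).trans h.r5, (hf 6 (by omega)).trans h.r6,
    (hf 7 (by omega)).trans h.r7, (hf 8 (by omega)).trans h.r8, (hf 10 (by omega)).trans h.r10⟩

/-- `ERegs` survives changes outside `11–13`. [folklore] -/
theorem ERegs.of_frame {m m' : ℕ → ℕ} (h : g.ERegs m) (hf : ∀ a, 11 ≤ a → a ≤ 13 → m' a = m a) :
    g.ERegs m' :=
  ⟨(hf 11 (by omega) (by omega)).trans h.r11, (hf 12 (by omega) (by omega)).trans h.r12,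
    (hf 13 (by omega) (by omega)).trans h.r13⟩

variable (g)

/-! ### Reading the relocated input -/

/-- Cell `0` after relocation holds `X`. [folklore] -/
@[simp] theorem relocated_zero' : relocated g.x 0 = g.X := by
  rw [relocated_zero]; rfl

/-- Cell `1` after relocation holds `X - 1`. [folklore] -/
@[simp] theorem relocated_one' : relocated g.x 1 = g.X - 1 := by
  rw [relocated_one]; unfold X Lx; omega

/-- The relocated input: `x[j]` sits in cell `X + j` (and `0` past the input). [folklore] -/
theorem relocated_X_add (j : ℕ) : relocated g.x (g.X + j) = g.x.getD j 0 := by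
  by_cases hj : j < g.Lx
  · have := relocated_base_add g.x (i := j + 1) (by omega) (by unfold Lx at hj; omega)
    rw [show g.x.length + 100 + (j + 1) = g.X + j by unfold X Lx; omega] at this
    rw [this]; rfl
  · rw [relocated_of_lt g.x (by unfold X Lx at *; omega),
      List.getD_eq_default _ _ (by unfold Lx at hj; omega)]

/-- Everything above the relocated input is `0`. [folklore] -/
theorem relocated_of_Bv_le {a : ℕ} (ha : g.Bv ≤ a) : relocated g.x a = 0 :=
  relocated_of_lt g.x (by unfold Bv X Lx at ha; omega)

/-- Word `0` of the input is `n = numVars`. [folklore] -/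
theorem x_getD_zero : g.x.getD 0 0 = g.n := by
  have := encodeCNFWords_getElem?_zero g.φ
  unfold x n; rw [List.getD_eq_getElem?_getD, this]; rfl

/-- Word `1` of the input is `m`. [folklore] -/
theorem x_getD_one : g.x.getD 1 0 = g.m := by
  have := encodeCNFWords_getElem?_one g.φ
  unfold x m; rw [List.getD_eq_getElem?_getD, this]; rfl

/-- `m + 2 ≤ Lx`. [folklore] -/
theorem m_add_two_le_Lx : g.m + 2 ≤ g.Lx := by
  unfold Lx x m; rw [length_encodeCNFWords_eq, CNF.numClauses]; omega

/-- `n` is an input word, hence below `2 ^ W`. [folklore] -/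
theorem n_lt {W : ℕ} (hF : g.Fits W) : g.n < 2 ^ W := by
  have h := hF.input (g.x.getD 0 0)
  rw [x_getD_zero] at h
  refine h ?_
  rw [← x_getD_zero, List.getD_eq_getElem _ _ (by have := g.two_le_Lx; unfold Lx at this; omega)]
  exact List.getElem_mem _

/-- The standard linear facts about the ghost parameters under `Fits` (`K ≥ 1`). [folklore] -/
theorem facts {W : ℕ} (hF : g.Fits W) (hK : 1 ≤ g.K) :
    100 < g.X ∧ g.X = g.Lx + 101 ∧ g.X + g.Lx = g.Bv ∧ g.Bv + g.V + 1 = g.Sv ∧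
    g.Sv + g.V + 1 ≤ 2 ^ W ∧ g.N * g.N + 2 ≤ g.V ∧ g.Pw ≤ g.V + 1 ∧ g.cM ≤ g.V ∧ g.K ≤ g.N ∧
    g.S ≤ g.KS ∧ g.KS + g.m + g.K = g.N ∧ g.m + 2 ≤ g.Lx ∧ g.N ≤ g.N * g.N ∧
    g.KS * g.N ≤ g.N * g.N ∧ 1 ≤ g.Pw ∧ 1 ≤ g.S ∧ g.n + g.K < 2 ^ W ∧ g.n < 2 ^ W := by
  obtain ⟨h1, h2, h3⟩ := g.bases
  have h4 := g.le_V
  have hS : g.S ≤ g.KS := Nat.le_mul_of_pos_left _ hK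
  have hKS : g.KS ≤ g.N := by unfold N; omega
  refine ⟨h1, rfl, h2, h3, hF.top, h4.1, by omega, h4.2.1, by unfold N; omega, hS, rfl,
    g.m_add_two_le_Lx, Nat.le_mul_self _, Nat.mul_le_mul_right _ hKS, Nat.one_le_two_pow,
    g.one_le_S, hF.nK, g.n_lt hF⟩

/-! ### The setup phase -/

variable {W : ℕ} {O : List ℕ → List ℕ}

/-- **Setup, part 1.** From the relocated memory, `setup1` computes the registers `Regs`, leaves
`r1 = X - 1`, `r21 = N² + 1`, `r22 = 0`, and does not touch the data. [folklore] -/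
theorem setup1_spec (hF : g.Fits W) (hK : 1 ≤ g.K) :
    Achieves W O (setup1 g.K) (relocated g.x)
      (fun m => g.Regs m ∧ m 1 = g.X - 1 ∧ m 21 = g.N * g.N + 1 ∧ m 22 = 0 ∧
        ∀ a, 100 ≤ a → m a = relocated g.x a) 16 := by
  obtain ⟨hX, hXLx, hBv, hSv, htop, hNNV, hPwV, hcMV, hKN, hSKS, hN, hmLx, hNNN, hKSN, hPw1, hS1,
    hnK, hnW⟩ := g.facts hF hK
  have hB : (g.n + (g.K - 1)) / g.K = g.B := by
    unfold B blockLen; congr 1; omega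
  have hS2 : 2 ^ g.B = g.S := rfl
  have hKS : g.K * g.S = g.KS := rfl
  have hreadn : relocated g.x g.X = g.n := by
    have := g.relocated_X_add 0; rw [Nat.add_zero] at this; rw [this, x_getD_zero]
  have hreadm : relocated g.x (g.X + 1) = g.m := by rw [relocated_X_add, x_getD_one]
  refine CliqueRed.achieves_block_of_eq (fun m' hm' => ?_) (by simp [])
  simp (disch := first | omega | decide) only [execOps_cons, execOps_nil, execOp, Operand.write,
    Operand.read, merge_apply_of_lt, merge_apply_of_le, update_merge_of_lt, Function.update_self,
    Function.update_of_ne, BinOp.eval_add_of_lt, BinOp.eval_sub_of_le, BinOp.eval_mul_of_lt,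
    BinOp.eval_shl_of_lt, BinOp.eval_div, BinOp.eval_band, Nat.and_self, Nat.one_mul,
    relocated_zero', relocated_one', hreadn, hreadm, hB, hS2, hKS, hN] at hm'
  subst hm'
  refine ⟨⟨?_, ?_, ?_, ?_, ?_, ?_, ?_, ?_, ?_⟩, ?_, ?_, ?_, fun a ha => ?_⟩
  all_goals (try simp (disch := first | omega | decide) only [merge_apply_of_lt,
    merge_apply_of_le, Function.update_self, Function.update_of_ne])
  all_goals (try simp only [relocated_zero', relocated_one'])
  all_goals omega

/-- **Setup, part 3.** From the registers of `setup1` and `r22 = size (N² + 1)`, `CliqueRed.setup3`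
sets the environment registers `Sv, Gv = 0, Pw` (`ERegs`), keeping `Regs` and the data.
(Same code and proof as `CliqueRed.Params.setup3_spec`, over this file's ghost parameters.)
[folklore] -/
theorem setup3_spec (hF : g.Fits W) (hK : 1 ≤ g.K) {m : ℕ → ℕ} (hR : g.Regs m)
    (h22 : m 22 = Nat.size (g.N * g.N + 1)) (hD : ∀ a, 100 ≤ a → m a = relocated g.x a) :
    Achieves W O (CliqueRed.setup3 g.kM g.cM) m
      (fun m' => g.Regs m' ∧ g.ERegs m' ∧ ∀ a, 100 ≤ a → m' a = relocated g.x a) 16 := by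
  obtain ⟨hX, hXLx, hBv, hSv, htop, hNNV, hPwV, hcMV, hKN, hSKS, hN, hmLx, hNNN, hKSN, hPw1, hS1,
    hnK, hnW⟩ := g.facts hF hK
  have hwsW : g.ws < W := hF.ws_lt
  have hW : W < 2 ^ W := Nat.lt_two_pow_self
  have hws : Nat.size (g.N * g.N + 1) * g.kM = g.ws := Nat.mul_comm _ _
  have hPw : 2 ^ g.ws = g.Pw := rfl
  have hPwW : g.Pw < 2 ^ W := Nat.pow_lt_pow_right (by norm_num) hwsW
  obtain ⟨r0, r2, r3, r4, r5, r6, r7, r8, r10⟩ := hR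
  unfold CliqueRed.setup3
  -- block 1
  refine Achieves.seqs_cons (R := fun m₁ => m₁ 13 = g.Pw ∧ m₁ 23 = g.Pw - 1 ∧
      m₁ 24 = (if g.Pw - 1 < g.cM then 1 else 0) ∧ ∀ a, a ≠ 13 → a ≠ 22 → a ≠ 23 → a ≠ 24 →
        m₁ a = m a) (T₁ := 4) (T₂ := 12) ?_ ?_
  · refine CliqueRed.achieves_block_of_eq (fun m' hm' => ?_) le_rfl
    simp (disch := first | omega | decide) only [execOps_cons, execOps_nil, execOp, Operand.write,
      Operand.read, merge_apply_of_lt, update_merge_of_lt, Function.update_self,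
      BinOp.eval_sub_of_le, BinOp.eval_mul_of_lt, BinOp.eval_shl_of_lt, BinOp.eval_lt,
      Nat.one_mul, h22, hws, hPw] at hm'
    subst hm'
    refine ⟨?_, ?_, ?_, fun a h1 h2 h3 h4 => ?_⟩
    · (try simp (disch := first | omega | decide) only [merge_apply_of_lt, Function.update_self,
      Function.update_of_ne])
    · (try simp (disch := first | omega | decide) only [merge_apply_of_lt, Function.update_self,
      Function.update_of_ne])
    · (try simp (disch := first | omega | decide) only [merge_apply_of_lt, Function.update_self])
    · by_cases ha : a < 100
      · rw [merge_apply_of_lt ha]; simp [Function.update_of_ne, h1, h2, h3, h4]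
      · rw [merge_apply_of_le (by omega)]
  rintro m₁ ⟨q13, q23, q24, qf⟩
  -- ifz 1
  refine Achieves.seqs_cons (R := fun m₂ => m₂ 23 = max (g.Pw - 1) g.cM ∧
      ∀ a, a ≠ 22 → a ≠ 23 → a ≠ 24 → m₂ a = m₁ a) (T₁ := 3) (T₂ := 9) ?_ ?_
  · refine Achieves.ifz (fun h0 => Achieves.skip ⟨?_, fun a _ _ _ => rfl⟩) (fun h1 => ?_)
    · simp only [Operand.read, q24] at h0
      have hc : ¬ g.Pw - 1 < g.cM := fun hc => by simp [hc] at h0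
      rw [q23, max_eq_left (not_lt.1 hc)]
    · simp only [Operand.read, q24] at h1
      have hlt : g.Pw - 1 < g.cM := by by_contra hc; simp [hc] at h1
      refine CliqueRed.achieves_block_of_eq (fun m' hm' => ?_) le_rfl
      simp (disch := first | omega | decide) only [execOps_cons, execOps_nil, execOp,
        Operand.write, Operand.read, update_merge_of_lt, BinOp.eval_band, Nat.and_self] at hm'
      subst hm'
      refine ⟨?_, fun a _ h23 _ => ?_⟩
      · (try simp (disch := first | omega | decide) only [merge_apply_of_lt,
        Function.update_self]); rw [max_eq_right hlt.le]
      · by_cases ha : a < 100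
        · rw [merge_apply_of_lt ha, Function.update_of_ne h23]
        · rw [merge_apply_of_le (by omega)]
  rintro m₂ ⟨p23, pf⟩
  have p6 : m₂ 6 = g.N := by
    rw [pf 6 (by omega) (by omega) (by omega), qf 6 (by omega) (by omega) (by omega) (by omega), r6]
  have hmaxV : max (g.Pw - 1) g.cM ≤ g.V := max_le (by omega) hcMV
  -- block 2
  refine Achieves.seqs_cons (R := fun m₃ => m₃ 23 = max (g.Pw - 1) g.cM ∧
      m₃ 25 = g.N * g.N + 2 ∧ m₃ 24 = (if max (g.Pw - 1) g.cM < g.N * g.N + 2 then 1 else 0) ∧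
      ∀ a, a ≠ 22 → a ≠ 23 → a ≠ 24 → a ≠ 25 → m₃ a = m₁ a) (T₁ := 3) (T₂ := 6) ?_ ?_
  · refine CliqueRed.achieves_block_of_eq (fun m' hm' => ?_) le_rfl
    simp (disch := first | omega | decide) only [execOps_cons, execOps_nil, execOp, Operand.write,
      Operand.read, merge_apply_of_lt, update_merge_of_lt, Function.update_self,
      Function.update_of_ne, BinOp.eval_add_of_lt, BinOp.eval_mul_of_lt, BinOp.eval_lt, p23,
      p6] at hm'
    subst hm'
    refine ⟨?_, ?_, ?_, fun a h1 h2 h3 h4 => ?_⟩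
    · (try simp (disch := first | omega | decide) only [merge_apply_of_lt,
      Function.update_of_ne]); exact p23
    · (try simp (disch := first | omega | decide) only [merge_apply_of_lt, Function.update_self,
      Function.update_of_ne])
    · (try simp (disch := first | omega | decide) only [merge_apply_of_lt, Function.update_self])
    · by_cases ha : a < 100
      · rw [merge_apply_of_lt ha]; simp [Function.update_of_ne, h3, h4, pf a h1 h2 h3]
      · rw [merge_apply_of_le (by omega), pf a h1 h2 h3]
  rintro m₃ ⟨s23, s25, s24, sf⟩
  -- ifz 2
  refine Achieves.seqs_cons (R := fun m₄ => m₄ 23 = g.V ∧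
      ∀ a, a ≠ 22 → a ≠ 23 → a ≠ 24 → a ≠ 25 → m₄ a = m₁ a) (T₁ := 3) (T₂ := 3) ?_ ?_
  · refine Achieves.ifz (fun h0 => Achieves.skip ⟨?_, sf⟩) (fun h1 => ?_)
    · simp only [Operand.read, s24] at h0
      have hc : ¬ max (g.Pw - 1) g.cM < g.N * g.N + 2 := fun hc => by simp [hc] at h0
      rw [s23]; show _ = max (g.Pw - 1) (max g.cM (g.N * g.N + 2))
      rw [← max_assoc, max_eq_left (not_lt.1 hc)]
    · simp only [Operand.read, s24] at h1
      have hlt : max (g.Pw - 1) g.cM < g.N * g.N + 2 := by by_contra hc; simp [hc] at h1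
      refine CliqueRed.achieves_block_of_eq (fun m' hm' => ?_) le_rfl
      simp (disch := first | omega | decide) only [execOps_cons, execOps_nil, execOp,
        Operand.write, Operand.read, merge_apply_of_lt, update_merge_of_lt, BinOp.eval_band,
        Nat.and_self, s25] at hm'
      subst hm'
      refine ⟨?_, fun a h22 h23 h24 h25 => ?_⟩
      · (try simp (disch := first | omega | decide) only [merge_apply_of_lt,
        Function.update_self]); show _ = max (g.Pw - 1) (max g.cM (g.N * g.N + 2))
        rw [← max_assoc, max_eq_right hlt.le]
      · by_cases ha : a < 100
        · rw [merge_apply_of_lt ha, Function.update_of_ne h23, sf a h22 h23 h24 h25]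
        · rw [merge_apply_of_le (by omega), sf a h22 h23 h24 h25]
  rintro m₄ ⟨t23, tf⟩
  have back : ∀ a, a ≠ 13 → a ≠ 22 → a ≠ 23 → a ≠ 24 → a ≠ 25 → m₄ a = m a :=
    fun a h1 h2 h3 h4 h5 => by rw [tf a h2 h3 h4 h5, qf a h1 h2 h3 h4]
  have t10 : m₄ 10 = g.Bv := by
    rw [back 10 (by omega) (by omega) (by omega) (by omega) (by omega), r10]
  -- block 3
  refine Achieves.seqs_cons (T₁ := 3) (T₂ := 0) ?_ (fun _ h => Achieves.seqs_nil h)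
  refine CliqueRed.achieves_block_of_eq (fun m' hm' => ?_) le_rfl
  simp (disch := first | omega | decide) only [execOps_cons, execOps_nil, execOp, Operand.write,
    Operand.read, merge_apply_of_lt, update_merge_of_lt, Function.update_self,
    BinOp.eval_add_of_lt, BinOp.eval_band, Nat.and_self, t23, t10] at hm'
  subst hm'
  refine ⟨⟨?_, ?_, ?_, ?_, ?_, ?_, ?_, ?_, ?_⟩, ⟨?_, ?_, ?_⟩, fun a ha => ?_⟩
  all_goals (try simp (disch := first | omega | decide) only [merge_apply_of_lt,
    merge_apply_of_le, Function.update_self, Function.update_of_ne])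
  · rw [back 0 (by omega) (by omega) (by omega) (by omega) (by omega), r0]
  · rw [back 2 (by omega) (by omega) (by omega) (by omega) (by omega), r2]
  · rw [back 3 (by omega) (by omega) (by omega) (by omega) (by omega), r3]
  · rw [back 4 (by omega) (by omega) (by omega) (by omega) (by omega), r4]
  · rw [back 5 (by omega) (by omega) (by omega) (by omega) (by omega), r5]
  · rw [back 6 (by omega) (by omega) (by omega) (by omega) (by omega), r6]
  · rw [back 7 (by omega) (by omega) (by omega) (by omega) (by omega), r7]
  · rw [back 8 (by omega) (by omega) (by omega) (by omega) (by omega), r8]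
  · exact t10
  · omega
  · rw [tf 13 (by omega) (by omega) (by omega) (by omega), q13]
  · rw [back a (by omega) (by omega) (by omega) (by omega) (by omega), hD a ha]

end Params

end DomSetRed

end Literature.Computability.FineGrained

/-!
## Verification of the build: the adjacency matrix, the header, the whole build
-/

namespace Literature.Computability.FineGrained

open Cryptography Cryptography.WordRAM Complexity Cryptography.WordRAM.SProg

namespace DomSetRed

/-! ### Satisfaction of a clause, literal by literal -/

section Sat

variable (φ : CNF ℕ) (B i μ j : ℕ)

/-- Literal `l` of clause `j` lies in group `i` and gets its polarity from the mask `μ`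
(`false` if there is no such literal). [folklore] -/
def litSat (l : ℕ) : Bool :=
  match CliqueRed.litAt φ j l with
  | some lit => (lit.1 / B == i) && (μ.testBit (lit.1 % B) == lit.2)
  | none => false

/-- One of the first `l` literals of clause `j` is satisfied by the partial assignment `(i, μ)`.
[folklore] -/
def satUpTo (l : ℕ) : Bool :=
  (List.range l).any fun t => litSat φ B i μ j t

variable {φ B i μ j}

/-- No literal scanned yet. [folklore] -/
theorem satUpTo_zero : satUpTo φ B i μ j 0 = false := by simp [satUpTo]

/-- One more literal scanned. [folklore] -/
theorem satUpTo_succ (l : ℕ) :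
    satUpTo φ B i μ j (l + 1) = (satUpTo φ B i μ j l || litSat φ B i μ j l) := by
  simp [satUpTo, List.range_succ, List.any_append]

/-- After the whole clause, `satUpTo` is `satB`. [folklore] -/
theorem satUpTo_length (hj : j < φ.length) : satUpTo φ B i μ j φ[j].length = satB φ B i μ j := by
  rw [Bool.eq_iff_iff, satB_eq_true_iff hj]
  simp only [satUpTo, List.any_eq_true, List.mem_range]
  constructor
  · rintro ⟨t, ht, hsat⟩
    unfold litSat at hsat
    rw [CliqueRed.litAt_of_lt hj ht] at hsat
    simp only [Bool.and_eq_true, beq_iff_eq] at hsat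
    exact ⟨_, List.getElem_mem ht, hsat.1, hsat.2⟩
  · rintro ⟨lit, hmem, hgrp, hbit⟩
    obtain ⟨t, ht, rfl⟩ := List.getElem_of_mem hmem
    refine ⟨t, ht, ?_⟩
    unfold litSat
    rw [CliqueRed.litAt_of_lt hj ht]
    simp [hgrp, hbit]

/-- **The literal bit as computed**, from the two halves of the literal code. [folklore] -/
theorem litSat_eq {l : ℕ} {lit : Literal ℕ} (h : CliqueRed.litAt φ j l = some lit) :
    (decide (lit.1 / B = i) && decide ((μ >>> (lit.1 % B)) &&& 1 = lit.2.toNat)) =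
      litSat φ B i μ j l := by
  obtain ⟨v, p⟩ := lit
  simp only [litSat, h, CliqueRed.shiftRight_and_one]
  cases p <;> cases μ.testBit (v % B) <;> simp [beq_eq_decide]

end Sat

/-- A comparison bit is the `beq` bit. [folklore] -/
theorem ite_eq_beq_toNat (u v : ℕ) : (if u = v then 1 else 0 : ℕ) = (u == v).toNat := by
  rw [beq_eq_decide]; by_cases h : u = v <;> simp [h]

namespace Params

variable (g : Params) {W : ℕ} {O : List ℕ → List ℕ}

/-! ### The three kinds of entries in closed form -/

/-- A group entry: the bit `a' / S = a / S`. [folklore] -/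
theorem grpVal_eq {a c : ℕ} (ha : a < g.KS) (hc : c < g.KS) :
    (if c / g.S = a / g.S then 1 else 0 : ℕ) % g.Pw = g.adjVal a c := by
  unfold adjVal; rw [pwAdj_group ha hc, ite_eq_beq_toNat]
  congr 2
  rw [Bool.eq_iff_iff]; simp only [beq_iff_eq]; exact eq_comm

/-- A clause entry: the bit `satB`. [folklore] -/
theorem clauseVal_eq {a j : ℕ} (ha : a < g.KS) (hj : j < g.m) :
    (satUpTo g.φ g.B (a / g.S) (a % g.S) j (g.φ[j]'hj).length).toNat % g.Pw = g.adjVal a (g.KS + j) := by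
  unfold adjVal KS; rw [pwAdj_clause ha hj, satUpTo_length hj]

/-- A dummy entry: the bit `i' = a / S`. [folklore] -/
theorem dumVal_eq {a i : ℕ} (ha : a < g.KS) (hi : i < g.K) :
    (if i = a / g.S then 1 else 0 : ℕ) % g.Pw = g.adjVal a (g.KS + g.m + i) := by
  unfold adjVal KS; rw [pwAdj_dummy ha hi, ite_eq_beq_toNat]
  congr 2
  rw [Bool.eq_iff_iff]; simp only [beq_iff_eq]; exact eq_comm

/-! ### Reading the clauses of the relocated input -/

/-- The length word of clause `j`. [folklore] -/
theorem x_getD_clauseStart {j : ℕ} (hj : j < g.m) :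
    g.x.getD (clauseStart g.φ j) 0 = (g.φ[j]'hj).length := by
  unfold x; rw [List.getD_eq_getElem?_getD, encodeCNFWords_getElem?_clauseStart g.φ hj]; rfl

/-- The code of literal `l` of clause `j`. [folklore] -/
theorem x_getD_lit {j : ℕ} (hj : j < g.m) {l : ℕ} (hl : l < (g.φ[j]'hj).length) :
    g.x.getD (clauseStart g.φ j + 1 + l) 0 = litCode ((g.φ[j]'hj)[l]'hl) := by
  unfold x; rw [List.getD_eq_getElem?_getD, encodeCNFWords_getElem?_clauseStart_succ g.φ hj hl]
  rfl

/-- Every clause block lies inside the input. [folklore] -/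
theorem clauseStart_le {j : ℕ} (hj : j < g.m) :
    clauseStart g.φ j + 1 + (g.φ[j]'hj).length ≤ g.Lx := by
  unfold Lx x; exact clauseStart_add_length_le g.φ hj

/-- The clause blocks end at `Lx`. [folklore] -/
theorem clauseStart_m_le : clauseStart g.φ g.m ≤ g.Lx := by
  unfold Lx x m; rw [length_encodeCNFWords]

/-- A literal code is an input word, hence below `2 ^ W`. [folklore] -/
theorem litCode_lt (hF : g.Fits W) {j : ℕ} (hj : j < g.m) {l : ℕ} (hl : l < (g.φ[j]'hj).length) :
    litCode ((g.φ[j]'hj)[l]'hl) < 2 ^ W := by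
  have h := g.x_getD_lit hj hl
  have hlen := g.clauseStart_le hj
  rw [List.getD_eq_getElem _ _ (by unfold Lx at hlen; omega)] at h
  rw [← h]
  exact hF.input _ (List.getElem_mem _)

/-! ### Stepping the data -/

/-- Stage `0` of the matrix is the relocated input. [folklore] -/
theorem matData_zero (a : ℕ) : g.matData 0 a = relocated g.x a := by
  unfold matData
  by_cases h1 : a < g.Bv
  · rw [if_pos h1]
  rw [if_neg h1, g.relocated_of_Bv_le (not_lt.1 h1)]
  split_ifs <;> first | rfl | omega

/-- **One entry written.** [folklore] -/
theorem matData_succ {q : ℕ} {m : ℕ → ℕ} (hm : ∀ a, 100 ≤ a → m a = g.matData q a) (a : ℕ)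
    (ha : 100 ≤ a) :
    Function.update m (g.Bv + 2 + q) (g.adjVal (q / g.N) (q % g.N)) a = g.matData (q + 1) a := by
  obtain ⟨hX, hBv, -⟩ := g.bases
  by_cases h1 : a = g.Bv + 2 + q
  · subst h1; rw [Function.update_self]; unfold matData
    rw [if_neg (by omega), if_neg (by omega), if_pos (by omega),
      show g.Bv + 2 + q - (g.Bv + 2) = q by omega]
  rw [Function.update_of_ne h1, hm a ha]
  unfold matData
  by_cases h3 : a < g.Bv
  · rw [if_pos h3, if_pos h3]
  rw [if_neg h3, if_neg h3]
  by_cases h4 : a < g.Bv + 2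
  · rw [if_pos h4, if_pos h4]
  rw [if_neg h4, if_neg h4]
  have : (a - (g.Bv + 2) < q) ↔ (a - (g.Bv + 2) < q + 1) := by omega
  simp only [this]

/-! ### Time constants -/

/-- The time of one clause column, for clauses of width `≤ k`. [folklore] -/
def Tcl (k : ℕ) : ℕ := 3 + (k * 18 + 1) + 4
/-- The time of one row, for clauses of width `≤ k`. [folklore] -/
def Trow (k : ℕ) : ℕ :=
  7 + (g.KS * 9 + 1) + 2 + (g.m * (Tcl k + 2) + 1) + 2 + (g.K * 8 + 1) + 2

/-! ### The loops of one row -/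

/-- The registers fixed during row `a`. [folklore] -/
structure RowRegs (a : ℕ) (m : ℕ → ℕ) : Prop where
  regs : g.Regs m
  eregs : g.ERegs m
  r30 : m 30 = a
  r31 : m 31 = g.KS - a
  r32 : m 32 = a / g.S
  r33 : m 33 = a % g.S

variable {g} in
/-- `RowRegs` survives changes above register `33`. [folklore] -/
theorem RowRegs.of_frame {a : ℕ} {m m' : ℕ → ℕ} (h : g.RowRegs a m)
    (hf : ∀ c, c ≤ 33 → m' c = m c) : g.RowRegs a m' :=
  ⟨h.regs.of_frame fun c hc => hf c (by omega), h.eregs.of_frame fun c _ hc => hf c (by omega),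
    (hf 30 (by omega)).trans h.r30, (hf 31 (by omega)).trans h.r31, (hf 32 (by omega)).trans h.r32,
    (hf 33 (by omega)).trans h.r33⟩

/-- The invariant of the group-column loop of row `a`. [folklore] -/
structure GrpInv (a col : ℕ) (m : ℕ → ℕ) : Prop where
  row : g.RowRegs a m
  r34 : m 34 = g.Bv + 2 + a * g.N + col
  r35 : m 35 = g.KS - col
  r36 : m 36 = col
  data : ∀ c, 100 ≤ c → m c = g.matData (a * g.N + col) c

/-- The invariant of the clause-column loop of row `a`. [folklore] -/
structure ClInv (a j : ℕ) (m : ℕ → ℕ) : Prop where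
  row : g.RowRegs a m
  r34 : m 34 = g.Bv + 2 + a * g.N + g.KS + j
  r35 : m 35 = g.m - j
  r38 : m 38 = g.X + clauseStart g.φ j
  data : ∀ c, 100 ≤ c → m c = g.matData (a * g.N + g.KS + j) c

/-- The invariant of the literal loop of clause `j` in row `a`. [folklore] -/
structure LitInv (a j Lj l : ℕ) (m : ℕ → ℕ) : Prop where
  row : g.RowRegs a m
  r34 : m 34 = g.Bv + 2 + a * g.N + g.KS + j
  r35 : m 35 = g.m - j
  r38 : m 38 = g.X + (clauseStart g.φ j + 1 + l)
  r39 : m 39 = Lj - l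
  r40 : m 40 = (satUpTo g.φ g.B (a / g.S) (a % g.S) j l).toNat
  data : ∀ c, 100 ≤ c → m c = g.matData (a * g.N + g.KS + j) c

/-- The invariant of the dummy-column loop of row `a`. [folklore] -/
structure DumInv (a i : ℕ) (m : ℕ → ℕ) : Prop where
  row : g.RowRegs a m
  r34 : m 34 = g.Bv + 2 + a * g.N + g.KS + g.m + i
  r35 : m 35 = g.K - i
  r36 : m 36 = i
  data : ∀ c, 100 ≤ c → m c = g.matData (a * g.N + g.KS + g.m + i) c

/-- The invariant of the row loop. [folklore] -/
structure RowInv (a : ℕ) (m : ℕ → ℕ) : Prop where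
  regs : g.Regs m
  eregs : g.ERegs m
  r30 : m 30 = a
  r31 : m 31 = g.KS - a
  data : ∀ c, 100 ≤ c → m c = g.matData (a * g.N) c

/-- Row arithmetic: the entries of row `a < K S` are among the first `N²`. [folklore] -/
theorem row_bound {a : ℕ} (ha : a < g.KS) : a * g.N + g.N ≤ g.N * g.N := by
  have hKS : g.KS ≤ g.N := by unfold N; omega
  calc a * g.N + g.N = (a + 1) * g.N := (Nat.succ_mul _ _).symm
    _ ≤ g.N * g.N := Nat.mul_le_mul_right _ (by omega)

/-- Entry `(a, col)` is entry `a N + col` of the row-major order (`col < N`). [folklore] -/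
theorem entry_divMod {a col : ℕ} (hcol : col < g.N) :
    (a * g.N + col) / g.N = a ∧ (a * g.N + col) % g.N = col := by
  have hN : 0 < g.N := by omega
  rw [Nat.mul_comm, Nat.mul_add_div hN, Nat.div_eq_of_lt hcol, Nat.add_zero, Nat.mul_add_mod,
    Nat.mod_eq_of_lt hcol]
  exact ⟨rfl, rfl⟩

/-- **One group entry.** [folklore] -/
theorem grpEntry_spec (hF : g.Fits W) (hK : 1 ≤ g.K) {a col : ℕ} (ha : a < g.KS) (hcol : col < g.KS)
    {m : ℕ → ℕ} (hI : g.GrpInv a col m) : Achieves W O grpEntry m (g.GrpInv a (col + 1)) 7 := by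
  obtain ⟨hX, hXLx, hBv, hSv, htop, hNNV, hPwV, hcMV, hKN, hSKS, hN, hmLx, hNNN, hKSN, hPw1, hS1,
    hnK, hnW⟩ := g.facts hF hK
  obtain ⟨hR, r34, r35, r36, hD⟩ := hI
  have haN := g.row_bound ha
  have r5 := hR.regs.r5; have r13 := hR.eregs.r13; have r32 := hR.r32
  have hval : (if col / g.S = a / g.S then 1 else 0 : ℕ) % g.Pw =
      g.adjVal ((a * g.N + col) / g.N) ((a * g.N + col) % g.N) := by
    obtain ⟨h1, h2⟩ := g.entry_divMod (a := a) (col := col) (by omega)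
    rw [h1, h2]; exact g.grpVal_eq ha hcol
  unfold grpEntry
  refine CliqueRed.achieves_block_of_eq (fun m' hm' => ?_) le_rfl
  simp (disch := first | omega | decide) only [execOps_cons, execOps_nil, execOp, Operand.write,
    Operand.read, merge_apply_of_lt, update_merge_of_lt, update_merge_of_le,
    Function.update_self, Function.update_of_ne, BinOp.eval_add_of_lt, BinOp.eval_sub_of_le,
    BinOp.eval_div, BinOp.eval_mod, BinOp.eval_band, BinOp.eval_eq, Nat.and_self, r5, r13, r32,
    r34, r35, r36] at hm'
  subst hm'
  refine ⟨hR.of_frame fun c hc => ?_, ?_, ?_, ?_, fun c hc => ?data⟩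
  case data =>
    (try simp (disch := first | omega | decide) only [merge_apply_of_le])
    rw [hval, show a * g.N + (col + 1) = a * g.N + col + 1 by omega,
      show g.Bv + 2 + a * g.N + col = g.Bv + 2 + (a * g.N + col) by omega]
    exact g.matData_succ hD c hc
  · rw [merge_apply_of_lt (by omega)]; simp (disch := omega) only [Function.update_of_ne]
  · (try simp (disch := first | omega | decide) only [merge_apply_of_lt, Function.update_self,
    Function.update_of_ne]); omega
  · (try simp (disch := first | omega | decide) only [merge_apply_of_lt, Function.update_self]); omega
  · (try simp (disch := first | omega | decide) only [merge_apply_of_lt, Function.update_self,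
    Function.update_of_ne])

/-- **One literal.** [folklore] -/
theorem litBody_spec (hF : g.Fits W) (hK : 1 ≤ g.K) {a j l : ℕ} (hj : j < g.m)
    (hl : l < (g.φ[j]'hj).length) {m : ℕ → ℕ} (hI : g.LitInv a j (g.φ[j]'hj).length l m) :
    Achieves W O litBody m (g.LitInv a j (g.φ[j]'hj).length (l + 1)) 16 := by
  obtain ⟨hX, hXLx, hBv, hSv, htop, hNNV, hPwV, hcMV, hKN, hSKS, hN, hmLx, hNNN, hKSN, hPw1, hS1,
    hnK, hnW⟩ := g.facts hF hK
  obtain ⟨hR, r34, r35, r38, r39, r40, hD⟩ := hI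
  have hcs := g.clauseStart_le hj
  set lit : Literal ℕ := (g.φ[j]'hj)[l]'hl with hlitdef
  have hlitAt : CliqueRed.litAt g.φ j l = some lit := CliqueRed.litAt_of_lt hj hl
  have hread : m (g.X + (clauseStart g.φ j + 1 + l)) = litCode lit := by
    rw [hD _ (by omega)]
    unfold matData; rw [if_pos (by omega), relocated_X_add, g.x_getD_lit hj hl]
  have hlitW : litCode lit < 2 ^ W := g.litCode_lt hF hj hl
  have r4 := hR.regs.r4; have r32 := hR.r32; have r33 := hR.r33
  unfold litBody
  refine CliqueRed.achieves_block_of_eq (fun m' hm' => ?_) le_rfl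
  simp (disch := first | omega | decide) only [execOps_cons, execOps_nil, execOp, Operand.write,
    Operand.read, merge_apply_of_lt, merge_apply_of_le, update_merge_of_lt,
    Function.update_self, Function.update_of_ne, BinOp.eval_add_of_lt, BinOp.eval_sub_of_le,
    BinOp.eval_div, BinOp.eval_mod, BinOp.eval_band, BinOp.eval_shr, BinOp.eval_eq, BinOp.eval_lt,
    Nat.and_self, CliqueRed.litCode_shiftRight_one, CliqueRed.litCode_and_one, r4, r32, r33, r38,
    r39, r40, hread] at hm'
  subst hm'
  refine ⟨hR.of_frame fun c hc => ?_, ?_, ?_, ?_, ?_, ?_, fun c hc => ?data⟩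
  case data =>
    (try simp (disch := first | omega | decide) only [merge_apply_of_le]); exact hD c hc
  · rw [merge_apply_of_lt (by omega)]; simp (disch := omega) only [Function.update_of_ne]
  · (try simp (disch := first | omega | decide) only [merge_apply_of_lt,
    Function.update_of_ne]); exact r34
  · (try simp (disch := first | omega | decide) only [merge_apply_of_lt,
    Function.update_of_ne]); exact r35
  · (try simp (disch := first | omega | decide) only [merge_apply_of_lt, Function.update_self,
    Function.update_of_ne]); omega
  · (try simp (disch := first | omega | decide) only [merge_apply_of_lt, Function.update_self]); omega
  · (try simp (disch := first | omega | decide) only [merge_apply_of_lt, Function.update_self,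
    Function.update_of_ne])
    rw [CliqueRed.or_toNat_bits, litSat_eq hlitAt, satUpTo_succ]

/-- **One clause column.** [folklore] -/
theorem clauseEntry_spec (hF : g.Fits W) (hK : 1 ≤ g.K) {k : ℕ} (hw : g.φ.IsWidthLE k) {a j : ℕ}
    (ha : a < g.KS) (hj : j < g.m) {m : ℕ → ℕ} (hI : g.ClInv a j m) :
    Achieves W O clauseEntry m (g.ClInv a (j + 1)) (Tcl k) := by
  obtain ⟨hX, hXLx, hBv, hSv, htop, hNNV, hPwV, hcMV, hKN, hSKS, hN, hmLx, hNNN, hKSN, hPw1, hS1,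
    hnK, hnW⟩ := g.facts hF hK
  obtain ⟨hR, r34, r35, r38, hD⟩ := hI
  have haN := g.row_bound ha
  have hcs := g.clauseStart_le hj
  set Lj := (g.φ[j]'hj).length with hLj
  have hLk : Lj ≤ k := hw _ (List.getElem_mem hj)
  have hread : m (g.X + clauseStart g.φ j) = Lj := by
    rw [hD _ (by omega)]
    unfold matData; rw [if_pos (by omega), relocated_X_add, g.x_getD_clauseStart hj]
  unfold clauseEntry Tcl
  refine Achieves.mono (T := 3 + ((k * 18 + 1) + (4 + 0))) ?_ (fun _ h => h) (by omega)
  -- block 1: read the length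
  refine Achieves.seqs_cons (R := g.LitInv a j Lj 0) ?_ fun m₁ h₁ => ?_
  · refine CliqueRed.achieves_block_of_eq (fun m' hm' => ?_) le_rfl
    simp (disch := first | omega | decide) only [execOps_cons, execOps_nil, execOp, Operand.write,
      Operand.read, merge_apply_of_lt, merge_apply_of_le, update_merge_of_lt,
      Function.update_of_ne, BinOp.eval_add_of_lt, BinOp.eval_band, Nat.and_self, r38, hread] at hm'
    subst hm'
    refine ⟨hR.of_frame fun c hc => ?_, ?_, ?_, ?_, ?_, ?_, fun c hc => ?data⟩
    case data => (try simp (disch := first | omega | decide) only [merge_apply_of_le]); exact hD c hc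
    · rw [merge_apply_of_lt (by omega)]; simp (disch := omega) only [Function.update_of_ne]
    · (try simp (disch := first | omega | decide) only [merge_apply_of_lt,
      Function.update_of_ne]); exact r34
    · (try simp (disch := first | omega | decide) only [merge_apply_of_lt,
      Function.update_of_ne]); exact r35
    · (try simp (disch := first | omega | decide) only [merge_apply_of_lt, Function.update_self,
      Function.update_of_ne]); omega
    · (try simp (disch := first | omega | decide) only [merge_apply_of_lt, Function.update_self,
      Function.update_of_ne]); omega
    · (try simp (disch := first | omega | decide) only [merge_apply_of_lt, Function.update_self]); rw [satUpTo_zero]; rfl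
  -- the literal loop
  refine Achieves.seqs_cons (R := g.LitInv a j Lj Lj) ?_ fun m₂ h₂ => ?_
  · refine Achieves.whilenz Lj 16 (fun l => g.LitInv a j Lj l)
      (fun l hl m' hI => ⟨?_, g.litBody_spec hF hK hj hl hI⟩) (fun m' hI => ?_) h₁ (fun _ h => h)
      (by nlinarith)
    · simp only [Operand.read, hI.r39]; omega
    · simp only [Operand.read, hI.r39]; omega
  -- block 3: write the bit
  obtain ⟨hR₂, s34, s35, s38, s39, s40, sD⟩ := h₂
  have s13 := hR₂.eregs.r13
  have hval : (satUpTo g.φ g.B (a / g.S) (a % g.S) j Lj).toNat % g.Pw =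
      g.adjVal ((a * g.N + g.KS + j) / g.N) ((a * g.N + g.KS + j) % g.N) := by
    obtain ⟨h1, h2⟩ := g.entry_divMod (a := a) (col := g.KS + j) (by omega)
    rw [Nat.add_assoc, h1, h2]; exact g.clauseVal_eq ha hj
  refine Achieves.seqs_cons (T₂ := 0) ?_ (fun _ h => Achieves.seqs_nil h)
  refine CliqueRed.achieves_block_of_eq (fun m' hm' => ?_) le_rfl
  simp (disch := first | omega | decide) only [execOps_cons, execOps_nil, execOp, Operand.write,
    Operand.read, merge_apply_of_lt, update_merge_of_lt, update_merge_of_le,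
    Function.update_self, Function.update_of_ne, BinOp.eval_add_of_lt, BinOp.eval_sub_of_le,
    BinOp.eval_mod, BinOp.eval_band, Nat.and_self, s13, s34, s35, s40] at hm'
  subst hm'
  refine ⟨hR₂.of_frame fun c hc => ?_, ?_, ?_, ?_, fun c hc => ?data⟩
  case data =>
    (try simp (disch := first | omega | decide) only [merge_apply_of_le])
    rw [hval, show a * g.N + g.KS + (j + 1) = a * g.N + g.KS + j + 1 by omega,
      show g.Bv + 2 + a * g.N + g.KS + j = g.Bv + 2 + (a * g.N + g.KS + j) by omega]
    exact g.matData_succ sD c hc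
  · rw [merge_apply_of_lt (by omega)]; simp (disch := omega) only [Function.update_of_ne]
  · (try simp (disch := first | omega | decide) only [merge_apply_of_lt, Function.update_self,
    Function.update_of_ne]); omega
  · (try simp (disch := first | omega | decide) only [merge_apply_of_lt, Function.update_self]); omega
  · (try simp (disch := first | omega | decide) only [merge_apply_of_lt,
    Function.update_of_ne]); rw [s38, clauseStart_succ g.φ hj]

/-- **One dummy entry.** [folklore] -/
theorem dumEntry_spec (hF : g.Fits W) (hK : 1 ≤ g.K) {a i : ℕ} (ha : a < g.KS) (hi : i < g.K)
    {m : ℕ → ℕ} (hI : g.DumInv a i m) : Achieves W O dumEntry m (g.DumInv a (i + 1)) 6 := by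
  obtain ⟨hX, hXLx, hBv, hSv, htop, hNNV, hPwV, hcMV, hKN, hSKS, hN, hmLx, hNNN, hKSN, hPw1, hS1,
    hnK, hnW⟩ := g.facts hF hK
  obtain ⟨hR, r34, r35, r36, hD⟩ := hI
  have haN := g.row_bound ha
  have r13 := hR.eregs.r13; have r32 := hR.r32
  have hval : (if i = a / g.S then 1 else 0 : ℕ) % g.Pw =
      g.adjVal ((a * g.N + g.KS + g.m + i) / g.N) ((a * g.N + g.KS + g.m + i) % g.N) := by
    obtain ⟨h1, h2⟩ := g.entry_divMod (a := a) (col := g.KS + g.m + i) (by omega)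
    rw [show a * g.N + g.KS + g.m + i = a * g.N + (g.KS + g.m + i) by omega, h1, h2]
    exact g.dumVal_eq ha hi
  unfold dumEntry
  refine CliqueRed.achieves_block_of_eq (fun m' hm' => ?_) le_rfl
  simp (disch := first | omega | decide) only [execOps_cons, execOps_nil, execOp, Operand.write,
    Operand.read, merge_apply_of_lt, update_merge_of_lt, update_merge_of_le,
    Function.update_self, Function.update_of_ne, BinOp.eval_add_of_lt, BinOp.eval_sub_of_le,
    BinOp.eval_mod, BinOp.eval_band, BinOp.eval_eq, Nat.and_self, r13, r32, r34, r35, r36] at hm'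
  subst hm'
  refine ⟨hR.of_frame fun c hc => ?_, ?_, ?_, ?_, fun c hc => ?data⟩
  case data =>
    (try simp (disch := first | omega | decide) only [merge_apply_of_le])
    rw [hval, show a * g.N + g.KS + g.m + (i + 1) = a * g.N + g.KS + g.m + i + 1 by omega,
      show g.Bv + 2 + a * g.N + g.KS + g.m + i = g.Bv + 2 + (a * g.N + g.KS + g.m + i) by omega]
    exact g.matData_succ hD c hc
  · rw [merge_apply_of_lt (by omega)]; simp (disch := omega) only [Function.update_of_ne]
  · (try simp (disch := first | omega | decide) only [merge_apply_of_lt, Function.update_self,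
    Function.update_of_ne]); omega
  · (try simp (disch := first | omega | decide) only [merge_apply_of_lt, Function.update_self]); omega
  · (try simp (disch := first | omega | decide) only [merge_apply_of_lt, Function.update_self,
    Function.update_of_ne])

/-- **One row.** [folklore] -/
theorem rowBody_spec (hF : g.Fits W) (hK : 1 ≤ g.K) {k : ℕ} (hw : g.φ.IsWidthLE k) {a : ℕ}
    (ha : a < g.KS) {m : ℕ → ℕ} (hI : g.RowInv a m) :
    Achieves W O rowBody m (g.RowInv (a + 1)) (g.Trow k) := by
  obtain ⟨hX, hXLx, hBv, hSv, htop, hNNV, hPwV, hcMV, hKN, hSKS, hN, hmLx, hNNN, hKSN, hPw1, hS1,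
    hnK, hnW⟩ := g.facts hF hK
  obtain ⟨hR, hE, r30, r31, hD⟩ := hI
  have haN := g.row_bound ha
  unfold rowBody Trow
  refine Achieves.mono (T := 7 + ((g.KS * 9 + 1) + (2 + ((g.m * (Tcl k + 2) + 1) + (2 +
    ((g.K * 8 + 1) + (2 + 0))))))) ?_ (fun _ h => h) (by omega)
  -- block A: group, mask, write pointer, counters
  refine Achieves.seqs_cons (R := g.GrpInv a 0) ?_ fun m₁ h₁ => ?_
  · have r5 := hR.r5; have r6 := hR.r6; have r7 := hR.r7; have r10 := hR.r10
    refine CliqueRed.achieves_block_of_eq (fun m' hm' => ?_) le_rfl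
    simp (disch := first | omega | decide) only [execOps_cons, execOps_nil, execOp, Operand.write,
      Operand.read, merge_apply_of_lt, update_merge_of_lt, Function.update_self,
      Function.update_of_ne, BinOp.eval_add_of_lt, BinOp.eval_mul_of_lt, BinOp.eval_div,
      BinOp.eval_mod, BinOp.eval_band, Nat.and_self, r5, r6, r7, r10, r30] at hm'
    subst hm'
    refine ⟨⟨hR.of_frame fun c hc => ?_, hE.of_frame fun c hc hc' => ?_, ?_, ?_, ?_, ?_⟩, ?_, ?_, ?_,
      fun c hc => ?data⟩
    case data =>
      (try simp (disch := first | omega | decide) only [merge_apply_of_le]); rw [Nat.add_zero]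
      exact hD c hc
    · rw [merge_apply_of_lt (by omega)]; simp (disch := omega) only [Function.update_of_ne]
    · rw [merge_apply_of_lt (by omega)]; simp (disch := omega) only [Function.update_of_ne]
    · (try simp (disch := first | omega | decide) only [merge_apply_of_lt,
      Function.update_of_ne]); exact r30
    · (try simp (disch := first | omega | decide) only [merge_apply_of_lt,
      Function.update_of_ne]); exact r31
    · (try simp (disch := first | omega | decide) only [merge_apply_of_lt, Function.update_self,
      Function.update_of_ne])
    · (try simp (disch := first | omega | decide) only [merge_apply_of_lt, Function.update_self,
      Function.update_of_ne])
    · (try simp (disch := first | omega | decide) only [merge_apply_of_lt, Function.update_self,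
      Function.update_of_ne]); omega
    · (try simp (disch := first | omega | decide) only [merge_apply_of_lt, Function.update_self,
      Function.update_of_ne]); omega
    · (try simp (disch := first | omega | decide) only [merge_apply_of_lt, Function.update_self])
  -- the group loop
  refine Achieves.seqs_cons (R := g.GrpInv a g.KS) ?_ fun m₂ h₂ => ?_
  · refine Achieves.whilenz g.KS 7 (fun col => g.GrpInv a col)
      (fun col hcol m' hI => ⟨?_, g.grpEntry_spec hF hK ha hcol hI⟩) (fun m' hI => ?_) h₁
      (fun _ h => h) le_rfl
    · simp only [Operand.read, hI.r35]; omega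
    · simp only [Operand.read, hI.r35]; omega
  -- block B: clause counter and pointer
  obtain ⟨hR₂, s34, s35, s36, sD⟩ := h₂
  refine Achieves.seqs_cons (R := g.ClInv a 0) ?_ fun m₃ h₃ => ?_
  · have s0 := hR₂.regs.r0; have s3 := hR₂.regs.r3
    refine CliqueRed.achieves_block_of_eq (fun m' hm' => ?_) le_rfl
    simp (disch := first | omega | decide) only [execOps_cons, execOps_nil, execOp, Operand.write,
      Operand.read, merge_apply_of_lt, update_merge_of_lt,
      Function.update_of_ne, BinOp.eval_add_of_lt, BinOp.eval_band, Nat.and_self, s0, s3] at hm'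
    subst hm'
    refine ⟨hR₂.of_frame fun c hc => ?_, ?_, ?_, ?_, fun c hc => ?data⟩
    case data =>
      (try simp (disch := first | omega | decide) only [merge_apply_of_le]); rw [Nat.add_zero]
      exact sD c hc
    · rw [merge_apply_of_lt (by omega)]; simp (disch := omega) only [Function.update_of_ne]
    · (try simp (disch := first | omega | decide) only [merge_apply_of_lt,
      Function.update_of_ne]); rw [s34]; omega
    · (try simp (disch := first | omega | decide) only [merge_apply_of_lt, Function.update_self,
      Function.update_of_ne]); omega
    · (try simp (disch := first | omega | decide) only [merge_apply_of_lt, Function.update_self]); rw [clauseStart_zero]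
  -- the clause loop
  refine Achieves.seqs_cons (R := g.ClInv a g.m) ?_ fun m₄ h₄ => ?_
  · refine Achieves.whilenz g.m (Tcl k) (fun j => g.ClInv a j)
      (fun j hj m' hI => ⟨?_, g.clauseEntry_spec hF hK hw ha hj hI⟩) (fun m' hI => ?_) h₃
      (fun _ h => h) le_rfl
    · simp only [Operand.read, hI.r35]; omega
    · simp only [Operand.read, hI.r35]; omega
  -- block C: dummy counter
  obtain ⟨hR₄, t34, t35, t38, tD⟩ := h₄
  refine Achieves.seqs_cons (R := g.DumInv a 0) ?_ fun m₅ h₅ => ?_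
  · have t8 := hR₄.regs.r8
    refine CliqueRed.achieves_block_of_eq (fun m' hm' => ?_) le_rfl
    simp (disch := first | omega | decide) only [execOps_cons, execOps_nil, execOp, Operand.write,
      Operand.read, merge_apply_of_lt, update_merge_of_lt,
      BinOp.eval_band, Nat.and_self, t8] at hm'
    subst hm'
    refine ⟨hR₄.of_frame fun c hc => ?_, ?_, ?_, ?_, fun c hc => ?data⟩
    case data =>
      (try simp (disch := first | omega | decide) only [merge_apply_of_le]); rw [Nat.add_zero]
      exact tD c hc
    · rw [merge_apply_of_lt (by omega)]; simp (disch := omega) only [Function.update_of_ne]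
    · (try simp (disch := first | omega | decide) only [merge_apply_of_lt,
      Function.update_of_ne]); rw [t34]; omega
    · (try simp (disch := first | omega | decide) only [merge_apply_of_lt, Function.update_self,
      Function.update_of_ne]); omega
    · (try simp (disch := first | omega | decide) only [merge_apply_of_lt, Function.update_self])
  -- the dummy loop
  refine Achieves.seqs_cons (R := g.DumInv a g.K) ?_ fun m₆ h₆ => ?_
  · refine Achieves.whilenz g.K 6 (fun i => g.DumInv a i)
      (fun i hi m' hI => ⟨?_, g.dumEntry_spec hF hK ha hi hI⟩) (fun m' hI => ?_) h₅
      (fun _ h => h) le_rfl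
    · simp only [Operand.read, hI.r35]; omega
    · simp only [Operand.read, hI.r35]; omega
  -- block D: next row
  obtain ⟨hR₆, -, -, -, uD⟩ := h₆
  have u30 := hR₆.r30; have u31 := hR₆.r31
  refine Achieves.seqs_cons (T₂ := 0) ?_ (fun _ h => Achieves.seqs_nil h)
  refine CliqueRed.achieves_block_of_eq (fun m' hm' => ?_) le_rfl
  simp (disch := first | omega | decide) only [execOps_cons, execOps_nil, execOp, Operand.write,
    Operand.read, merge_apply_of_lt, update_merge_of_lt,
    Function.update_of_ne, BinOp.eval_add_of_lt, BinOp.eval_sub_of_le, u30, u31] at hm'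
  subst hm'
  refine ⟨hR₆.regs.of_frame fun c hc => ?_, hR₆.eregs.of_frame fun c hc hc' => ?_, ?_, ?_,
    fun c hc => ?data⟩
  case data =>
    (try simp (disch := first | omega | decide) only [merge_apply_of_le])
    rw [uD c hc, show a * g.N + g.KS + g.m + g.K = (a + 1) * g.N by rw [← hN]; ring]
  · rw [merge_apply_of_lt (by omega)]; simp (disch := omega) only [Function.update_of_ne]
  · rw [merge_apply_of_lt (by omega)]; simp (disch := omega) only [Function.update_of_ne]
  · (try simp (disch := first | omega | decide) only [merge_apply_of_lt, Function.update_self,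
    Function.update_of_ne])
  · (try simp (disch := first | omega | decide) only [merge_apply_of_lt, Function.update_self]); omega

/-- **The adjacency matrix** (rows `a < K S`). [folklore] -/
theorem matrix_spec (hF : g.Fits W) (hK : 1 ≤ g.K) {k : ℕ} (hw : g.φ.IsWidthLE k) {m : ℕ → ℕ}
    (hR : g.Regs m) (hE : g.ERegs m) (hD : ∀ a, 100 ≤ a → m a = relocated g.x a) :
    Achieves W O matrix m (g.RowInv g.KS) (g.KS * (g.Trow k + 2) + 3) := by
  obtain ⟨hX, hXLx, hBv, hSv, htop, hNNV, hPwV, hcMV, hKN, hSKS, hN, hmLx, hNNN, hKSN, hPw1, hS1,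
    hnK, hnW⟩ := g.facts hF hK
  unfold matrix
  refine Achieves.mono (T := 2 + ((g.KS * (g.Trow k + 2) + 1) + 0)) ?_ (fun _ h => h) (by omega)
  refine Achieves.seqs_cons (R := g.RowInv 0) ?_ fun m₁ h₁ => ?_
  · have r7 := hR.r7
    refine CliqueRed.achieves_block_of_eq (fun m' hm' => ?_) le_rfl
    simp (disch := first | omega | decide) only [execOps_cons, execOps_nil, execOp, Operand.write,
      Operand.read, merge_apply_of_lt, update_merge_of_lt, Function.update_of_ne, BinOp.eval_band,
      Nat.and_self, r7] at hm'
    subst hm'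
    refine ⟨hR.of_frame fun c hc => ?_, hE.of_frame fun c hc hc' => ?_, ?_, ?_, fun c hc => ?data⟩
    case data =>
      (try simp (disch := first | omega | decide) only [merge_apply_of_le])
      rw [hD c hc, Nat.zero_mul, g.matData_zero]
    · rw [merge_apply_of_lt (by omega)]; simp (disch := omega) only [Function.update_of_ne]
    · rw [merge_apply_of_lt (by omega)]; simp (disch := omega) only [Function.update_of_ne]
    · (try simp (disch := first | omega | decide) only [merge_apply_of_lt, Function.update_self,
      Function.update_of_ne])
    · (try simp (disch := first | omega | decide) only [merge_apply_of_lt,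
      Function.update_self]); omega
  refine Achieves.seqs_cons ?_ (fun _ h => Achieves.seqs_nil h)
  refine Achieves.whilenz g.KS (g.Trow k) (fun a => g.RowInv a)
    (fun a ha m' hI => ⟨?_, g.rowBody_spec hF hK hw ha hI⟩) (fun m' hI => ?_) h₁ (fun _ h => h)
    le_rfl
  · simp only [Operand.read, hI.r31]; omega
  · simp only [Operand.read, hI.r31]; omega

/-! ### The cells of the emulated input -/

/-- Emulated cell `0`: the length `N² + 1`. [folklore] -/
theorem ycell_zero : g.ycell 0 = (g.N * g.N + 1) % g.Pw := rfl

/-- Emulated cell `1`: `N`. [folklore] -/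
theorem ycell_one : g.ycell 1 = g.N % g.Pw := by
  unfold ycell y
  rw [if_neg one_ne_zero, List.getD_eq_getElem?_getD, kDominatingSet_encode_pwInstance_getElem?_zero,
    ← g.N_eq]
  rfl

/-- Emulated cell `q + 2`, `q < N²`: the adjacency bit of `(q / N, q % N)`. [folklore] -/
theorem ycell_entry {q : ℕ} (hq : q < g.N * g.N) : g.ycell (q + 2) = g.adjVal (q / g.N) (q % g.N) := by
  have hN : 0 < g.N := Nat.pos_of_ne_zero fun h => by rw [h] at hq; simp at hq
  have ha : q / g.N < g.N := Nat.div_lt_of_lt_mul hq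
  have ha' : q % g.N < g.N := Nat.mod_lt _ hN
  have := kDominatingSet_encode_pwInstance_getElem?_entry g.φ g.K (a := q / g.N) (c := q % g.N)
    (g.N_eq ▸ ha) (g.N_eq ▸ ha')
  rw [← g.N_eq, Nat.div_add_mod' q g.N] at this
  unfold ycell y adjVal
  rw [if_neg (by omega), List.getD_eq_getElem?_getD, show q + 2 - 1 = 1 + q by omega, this]
  rfl

/-- **The header written**: from the end of the matrix, the two header cells make the data
final (the rows `a ≥ K S`, never written, are the zero rows of `pwAdj`). [folklore] -/
theorem finData_header {m : ℕ → ℕ} (hm : ∀ a, 100 ≤ a → m a = g.matData (g.KS * g.N) a) (a : ℕ)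
    (ha : 100 ≤ a) :
    Function.update (Function.update m g.Bv ((g.N * g.N + 1) % g.Pw)) (g.Bv + 1) (g.N % g.Pw) a =
      g.finData a := by
  obtain ⟨hX, hBv, -⟩ := g.bases
  unfold finData
  by_cases h1 : a = g.Bv + 1
  · subst h1
    rw [Function.update_self, if_neg (by omega), if_pos (by omega), Nat.add_sub_cancel_left, ycell_one]
  rw [Function.update_of_ne h1]
  by_cases h0 : a = g.Bv
  · subst h0; rw [Function.update_self, if_neg (by omega), if_pos (by omega), Nat.sub_self, ycell_zero]
  rw [Function.update_of_ne h0, hm a ha]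
  unfold matData
  by_cases h3 : a < g.Bv
  · rw [if_pos h3, if_pos h3]
  rw [if_neg h3, if_neg h3, if_neg (by omega)]
  by_cases h7 : a - (g.Bv + 2) < g.N * g.N
  · rw [if_pos (show a < g.Bv + (g.N * g.N + 2) by omega),
      show a - g.Bv = (a - (g.Bv + 2)) + 2 by omega, g.ycell_entry h7]
    by_cases h8 : a - (g.Bv + 2) < g.KS * g.N
    · rw [if_pos h8]
    · rw [if_neg h8]
      have hN : 0 < g.N := Nat.pos_of_ne_zero fun h => by rw [h] at h7; simp at h7
      have hle : g.K * g.S ≤ (a - (g.Bv + 2)) / g.N := (Nat.le_div_iff_mul_le hN).2 (not_lt.1 h8)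
      unfold adjVal; rw [pwAdj_of_le hle]; rfl
  · have hKSN : g.KS * g.N ≤ g.N * g.N := Nat.mul_le_mul_right _ (by unfold N; omega)
    rw [if_neg (by omega), if_neg (by omega)]

/-! ### The whole build -/

/-- The time of the build, for clauses of width `≤ k`. [folklore] -/
def Tpre (k : ℕ) : ℕ :=
  7 * g.Lx + 16 + (Nat.size (g.N * g.N + 1) * 4 + 1) + 16 + (g.KS * (g.Trow k + 2) + 3) + 7 + 96

/-- **The build.** On the initial memory of the input `x = encodeCNFWords φ` (word size `W` with
`g.Fits W`, `K ≥ 1`, width `≤ k`), `pre` ends, within `Tpre k` steps, in the closed-form memory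
`finMem`: environment registers `Bv, Sv, 0, Pw`, all other registers `0`, and the data `finData`
(relocated input and the emulated `kDominatingSet K` input). [folklore] -/
theorem pre_spec (hF : g.Fits W) (hK : 1 ≤ g.K) {k : ℕ} (hw : g.φ.IsWidthLE k) :
    Achieves W O (pre g.K g.kM g.cM) (initFun g.x) (fun m => m = g.finMem) (g.Tpre k) := by
  obtain ⟨hX, hXLx, hBv, hSv, htop, hNNV, hPwV, hcMV, hKN, hSKS, hN, hmLx, hNNN, hKSN, hPw1, hS1,
    hnK, hnW⟩ := g.facts hF hK
  unfold pre Tpre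
  refine Achieves.mono (T := 7 * g.Lx + (16 + ((Nat.size (g.N * g.N + 1) * 4 + 1) + (16 +
    ((g.KS * (g.Trow k + 2) + 3) + (7 + (96 + 0))))))) ?_ (fun _ h => h) (by omega)
  -- relocate
  refine Achieves.seqs_cons (R := fun m => m = relocated g.x) (T₁ := 7 * g.Lx)
    (fun qs => ⟨relocated g.x, 7 * g.Lx, le_rfl, ?_, rfl⟩) ?_
  · have h2 := g.two_le_Lx
    unfold Lx at h2 hXLx
    exact relocate_exec (by omega) hF.input (by unfold Lx at hBv; omega) qs
  rintro m rfl
  -- setup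
  refine Achieves.seqs_cons (g.setup1_spec hF hK) ?_
  rintro m₁ ⟨hR₁, -, h21, h22, hD₁⟩
  refine Achieves.seqs_cons (CliqueRed.Params.sizeLoop_spec (O := O) h21 h22 (by omega)) ?_
  rintro m₂ ⟨s22, -, sf⟩
  have hR₂ : g.Regs m₂ := hR₁.of_frame fun a ha => sf a (by omega) (by omega)
  have hD₂ : ∀ a, 100 ≤ a → m₂ a = relocated g.x a := fun a ha => by
    rw [sf a (by omega) (by omega), hD₁ a ha]
  refine Achieves.seqs_cons (g.setup3_spec hF hK hR₂ s22 hD₂) ?_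
  rintro m₃ ⟨hR₃, hE₃, hD₃⟩
  -- matrix
  refine Achieves.seqs_cons (g.matrix_spec hF hK hw hR₃ hE₃ hD₃) fun m₄ h₄ => ?_
  obtain ⟨hR₄, hE₄, -, -, hD₄⟩ := h₄
  -- header
  refine Achieves.seqs_cons (R := fun m₅ => g.Regs m₅ ∧ g.ERegs m₅ ∧ ∀ a,
    100 ≤ a → m₅ a = g.finData a) (T₁ := 7) ?_ ?_
  · obtain ⟨r0, r2, r3, r4, r5, r6, r7, r8, r10⟩ := hR₄
    obtain ⟨r11, r12, r13⟩ := hE₄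
    refine CliqueRed.achieves_block_of_eq (fun m' hm' => ?_) le_rfl
    simp (disch := first | omega | decide) only [execOps_cons, execOps_nil, execOp, Operand.write,
      Operand.read, merge_apply_of_lt, update_merge_of_lt, update_merge_of_le,
      Function.update_self, Function.update_of_ne, BinOp.eval_add_of_lt, BinOp.eval_mul_of_lt,
      BinOp.eval_mod, BinOp.eval_band, Nat.and_self, r6, r10, r13] at hm'
    subst hm'
    refine ⟨⟨?_, ?_, ?_, ?_, ?_, ?_, ?_, ?_, ?_⟩, ⟨?_, ?_, ?_⟩, fun a ha => ?data⟩
    case data =>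
      (try simp (disch := first | omega | decide) only [merge_apply_of_le])
      exact g.finData_header hD₄ a ha
    all_goals (try simp (disch := first | omega | decide) only [merge_apply_of_lt,
      Function.update_of_ne])
    all_goals assumption
  rintro m₅ ⟨hR₅, hE₅, hD₅⟩
  -- clearing
  refine Achieves.seqs_cons (T₁ := 96) (T₂ := 0) ?_ fun _ h => Achieves.seqs_nil h
  refine Achieves.block ?_ (by rw [List.length_map, CliqueRed.length_clearedRegs])
  show execOps W m₅ (CliqueRed.clearedRegs.map fun i =>
    ((.band, CliqueRed.r i, CliqueRed.im 0, CliqueRed.im 0) : OpSpec)) = g.finMem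
  rw [CliqueRed.execOps_clear]
  funext a
  unfold finMem
  simp only [CliqueRed.mem_clearedRegs]
  by_cases ha : a < 100
  · rw [if_pos ha]
    by_cases h10 : a = 10; · subst h10; simp [hR₅.r10]
    by_cases h11 : a = 11; · subst h11; simp [hE₅.r11]
    by_cases h12 : a = 12; · subst h12; simp [hE₅.r12]
    by_cases h13 : a = 13; · subst h13; simp [hE₅.r13]
    rw [if_pos ⟨ha, by omega⟩, if_neg h10, if_neg h11, if_neg h13]
  · rw [if_neg (by omega), if_neg ha, hD₅ a (by omega)]

end Params

end DomSetRed

end Literature.Computability.FineGrained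

/-!
## The run, the word size, the time
-/

namespace Literature.Computability.FineGrained

open Cryptography Cryptography.WordRAM Complexity Cryptography.WordRAM.SProg

namespace DomSetRed

namespace Params

variable (g : Params) {W : ℕ} {O : List ℕ → List ℕ}

/-! ### The run -/

/-- The emulator's side conditions hold for the layout and the environment. [folklore] -/
theorem envOK (hF : g.Fits W) (hK : 1 ≤ g.K) : EnvOK CliqueRed.lay g.env W := by
  obtain ⟨hX, hXLx, hBv, hSv, htop, -⟩ := g.facts hF hK
  refine ⟨by decide, by decide, by decide, by decide, by decide, by decide, by decide,
    fun r hr => ?_, Or.inl ?_, ?_, ?_, hF.ws_lt.le⟩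
  · simp only [CliqueRed.lay, Layout.regs, List.mem_cons, List.not_mem_nil, or_false] at hr
    show r < g.Bv ∧ r < g.Sv
    rcases hr with rfl | rfl | rfl | rfl | rfl | rfl | rfl <;> omega
  · show g.Bv + (g.V + 1) ≤ g.Sv; omega
  · show g.Bv + (g.V + 1) ≤ 2 ^ W; omega
  · show g.Sv + (g.V + 1) ≤ 2 ^ W; omega

/-- Every cell of the final memory is below `2 ^ W`. [folklore] -/
theorem finMem_lt (hF : g.Fits W) (hK : 1 ≤ g.K) (a : ℕ) : g.finMem a < 2 ^ W := by
  obtain ⟨hX, hXLx, hBv, hSv, htop, hNNV, hPwV, -⟩ := g.facts hF hK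
  unfold finMem
  by_cases ha : a < 100
  · rw [if_pos ha]; split_ifs <;> omega
  rw [if_neg ha]
  unfold finData
  split_ifs
  · exact lt_of_le_of_lt (CliqueRed.relocated_le_of_forall (B := 2 ^ W - 1)
      (fun v hv => Nat.le_sub_one_of_lt (hF.input v hv)) (by omega)) (by omega)
  · have : g.ycell (a - g.Bv) < g.Pw := by
      unfold ycell; split_ifs <;> exact Nat.mod_lt _ (Nat.two_pow_pos _)
    omega
  · exact Nat.two_pow_pos W

/-- **The target invariant at the end of the build.** [folklore] -/
theorem tinv_finMem (hF : g.Fits W) (hK : 1 ≤ g.K) : TInv CliqueRed.lay g.env (2 ^ W - 1) g.finMem := by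
  obtain ⟨hX, hXLx, hBv, hSv, htop, hNNV, -⟩ := g.facts hF hK
  refine ⟨⟨?_, ?_, ?_, ?_⟩, fun a _ => ?_, fun a => Nat.le_sub_one_of_lt (g.finMem_lt hF hK a)⟩
  · show g.finMem 10 = g.Bv; simp [finMem]
  · show g.finMem 11 = g.Sv; simp [finMem]
  · show g.finMem 12 = 0; simp [finMem]
  · show g.finMem 13 = 2 ^ g.ws; simp [finMem]; rfl
  · show g.finMem (g.Sv + a) ≤ 0
    unfold finMem finData
    rw [if_neg (by omega), if_neg (by omega), if_neg (by omega)]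

/-- **The emulated input is in place at the end of the build**: below the region size, the
emulated memory is the initial memory of the dominating-set program on `y` at word size `ws`.
[folklore] -/
theorem agree_finMem (hF : g.Fits W) (hK : 1 ≤ g.K) : Agree g.env g.finMem (init g.ws g.y).mem := by
  obtain ⟨hX, hXLx, hBv, hSv, htop, hNNV, -⟩ := g.facts hF hK
  have hlen : g.y.length = g.N * g.N + 1 := by
    unfold y; rw [length_kDominatingSet_encode_pwInstance, ← g.N_eq, sq]
  intro a _
  have hstamp : g.finMem (g.Sv + a) = 0 := by
    unfold finMem finData
    rw [if_neg (by omega), if_neg (by omega), if_neg (by omega)]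
  show (if g.finMem (g.Sv + a) = 0 then g.finMem (g.Bv + a) else 0) = (init g.ws g.y).mem a
  rw [if_pos hstamp]
  unfold finMem finData
  rw [if_neg (by omega), if_neg (by omega), Nat.add_sub_cancel_left]
  rcases Nat.lt_or_ge a (g.N * g.N + 2) with ha | ha
  · rw [if_pos (by omega)]
    unfold ycell
    rcases Nat.eq_zero_or_pos a with rfl | hpos
    · rw [if_pos rfl, init_mem_zero, hlen]; rfl
    · obtain ⟨j, rfl⟩ := Nat.exists_eq_add_of_le' hpos
      rw [if_neg (by omega), Nat.add_sub_cancel, init_mem_succ _ _ _ (by omega),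
        List.getD_eq_getElem _ _ (by omega)]; rfl
  · rw [if_neg (by omega), init_mem_of_length_lt _ _ _ (by omega)]

/-- **The read-out.** From any memory agreeing with the halting memory `dm` of the dominating-set
program (target invariant kept), `CliqueRed.post` outputs `[dm 1]` in `3` steps. (Same code and
proof as `CliqueRed.Params.post_spec`, over this file's ghost parameters.) [folklore] -/
theorem post_spec (hF : g.Fits W) (hK : 1 ≤ g.K) {m₂ dm : ℕ → ℕ} (hag : Agree g.env m₂ dm)
    (hI : TInv CliqueRed.lay g.env (2 ^ W - 1) m₂) (qs : List (List ℕ)) :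
    ∃ (st₃ : Store) (t₃ : ℕ), t₃ ≤ 3 ∧ Exec W O CliqueRed.post ⟨m₂, qs⟩ st₃ t₃ ∧
      readOut st₃.mem = [dm 1] := by
  obtain ⟨hX, hXLx, hBv, hSv, htop, hNNV, -⟩ := g.facts hF hK
  have h10 : m₂ 10 = g.Bv := hI.env.1
  have hst : m₂ (g.Sv + 1) = 0 := Nat.le_zero.1 (hI.stamp 1 (by show 1 < g.V + 1; omega))
  have h1 : m₂ (g.Bv + 1) = dm 1 := by
    have := hag 1 (by show 1 < g.V + 1; omega)
    simp only [edec, Params.env, hst, if_true] at this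
    exact this
  refine ⟨_, 3, le_rfl, Exec.block _ m₂ qs, ?_⟩
  have hm : execOps W m₂ [(.add, CliqueRed.r 17, CliqueRed.r 10, CliqueRed.im 1),
      (.band, CliqueRed.r 1, CliqueRed.pt 17, CliqueRed.pt 17),
      (.band, CliqueRed.r 0, CliqueRed.im 1, CliqueRed.im 1)] =
      Function.update (Function.update (Function.update m₂ 17 (g.Bv + 1)) 1 (dm 1)) 0 1 := by
    simp (disch := first | omega | decide) only [execOps_cons, execOps_nil, execOp, Operand.write,
      Operand.read, Function.update_self, Function.update_of_ne, h10, BinOp.eval_add_of_lt,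
      BinOp.eval_band, Nat.and_self]
    rw [h1]
  show readOut (execOps W m₂ _) = _
  rw [hm]
  simp [readOut, readSeg, Function.update_self, Function.update_of_ne]

/-- The total time of the reduction program, given a time bound `T` for the dominating-set program
and the width `k`. [folklore] -/
def Ttotal (k T : ℕ) : ℕ := g.Tpre k + cstep * T + 4

/-- **The reduction program's output.** At a word size `W` with `g.Fits W` (`K ≥ 1`, width `≤ k`),
if the deterministic oracle-free dominating-set program `M` (largest constant `cM`) outputs `[bit]`
on the Pătraşcu–Williams instance `y` at word size `ws = kM · width` within `T` steps, then the
reduction program outputs `[bit]` on `x = encodeCNFWords φ` within `Tpre + 38 T + 4` steps.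
[folklore] -/
theorem reduction_outputsWithin (hF : g.Fits W) (hK : 1 ≤ g.K) {k : ℕ} (hw : g.φ.IsWidthLE k)
    {M : Program} (hdet : M.IsDeterministic) (hof : M.IsOracleFree) (hcM : M.maxConst = g.cM)
    {T bit : ℕ} (hM : OutputsWithin M g.ws noOracle zeroCoins g.y [bit] T) :
    OutputsWithin (withSubrun (pre g.K g.kM g.cM) CliqueRed.lay M CliqueRed.post) W noOracle
      zeroCoins g.x [bit] (g.Ttotal k T) := by
  obtain ⟨hX, hXLx, hBv, hSv, htop, hNNV, hPwV, hcMV, -⟩ := g.facts hF hK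
  have hW1 : 1 ≤ W := by have := hF.ws_lt; omega
  obtain ⟨st₁, t₁, ht₁, hexec, hmem, hqs⟩ := (g.pre_spec (O := noOracle) hF hK hw).exists_exec
  obtain ⟨dh, hhalt, hout⟩ := (outputsWithin_iff_exists_haltsWithin _ _ _ _ _ _ _).1 hM
  have hst₁ : st₁ = ⟨g.finMem, []⟩ := by cases st₁; simp only at hmem hqs; rw [hmem, hqs]
  subst hst₁
  have key := outputsWithin_withSubrun (O := noOracle) zeroCoins (pre := pre g.K g.kM g.cM)
    (post := CliqueRed.post) (L := CliqueRed.lay) (E := g.env) (VT := 2 ^ W - 1) (V := g.V) (M := M)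
    (x := g.x) (y := g.y) (out := [bit]) (T₂ := 3) hF.width hexec (g.envOK hF hK) (by omega)
    (by omega)
    (fun r hr => by
      simp only [CliqueRed.lay, Layout.regs, List.mem_cons, List.not_mem_nil, or_false] at hr
      rcases hr with rfl | rfl | rfl | rfl | rfl | rfl | rfl <;> omega)
    hdet hof (by rw [hcM]; exact hcMV) (by show g.V < g.V + 1; omega) (by omega)
    (by show 2 ^ g.ws - 1 ≤ g.V; have := g.le_V; unfold Pw at this; omega) (by omega)
    (g.tinv_finMem hF hK) (g.agree_finMem hF hK) hhalt
    (fun m₂ hag hI _ => by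
      have := g.post_spec (O := noOracle) hF hK hag hI []
      rwa [CliqueRed.mem_one_of_readOut hout] at this)
  exact key.mono (by unfold Ttotal; omega)

/-! ### The word-size constant -/

/-- `B ≤ n`: a group is not longer than the list of all variables (`K ≥ 1`). [folklore] -/
theorem B_le_n (hK : 1 ≤ g.K) : g.B ≤ g.n := by
  unfold B blockLen
  rcases Nat.eq_zero_or_pos g.n with h | h
  · rw [h, Nat.zero_add, Nat.div_eq_of_lt (by omega)]
  · apply Nat.div_le_of_le_mul
    have h1 := Nat.mul_le_mul_left (g.K - 1) h
    have h2 : g.n ≤ g.K * g.n := Nat.le_mul_of_pos_left _ hK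
    rw [Nat.mul_one, Nat.sub_one_mul] at h1
    omega

/-- **The word-size constant** of the reduction: with `W = kfit · (n + inputWidth x)` every address
and value of the run fits (`fits`). [folklore] -/
def kfit (K kM cM : ℕ) : ℕ :=
  Nat.size (2 * ((2 * K + 1) * (2 * K + 1) + 2) + 2 * cM + 107) +
    kM * Nat.size ((2 * K + 1) * (2 * K + 1) + 2) + 2 * kM + 5

/-- **The word size fits.** For `K ≥ 1`, the run at word size `kfit · (n + inputWidth x)` satisfies
`Fits`. [folklore] -/
theorem fits (hK : 1 ≤ g.K) : g.Fits (kfit g.K g.kM g.cM * (g.n + inputWidth g.x)) := by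
  -- notation
  set n := g.n with hn
  set w := inputWidth g.x with hw
  set K2 := (2 * g.K + 1) * (2 * g.K + 1) + 2 with hK2
  set A := 2 * K2 + 2 * g.cM + 107 with hA
  set sK := Nat.size K2 with hsK
  set E := n + w with hE
  have hw1 : 1 ≤ w := inputWidth_pos _
  have hLx : g.Lx < 2 ^ w := length_lt_two_pow_inputWidth _
  have hnw : n < 2 ^ w := by
    have h := lt_two_pow_inputWidth_of_mem g.x (g.x.getD 0 0)
    rw [x_getD_zero] at h
    refine h ?_
    rw [← x_getD_zero, List.getD_eq_getElem _ _ (by have := g.two_le_Lx; unfold Lx at this; omega)]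
    exact List.getElem_mem _
  obtain ⟨hX, hBv, hSv⟩ := g.bases
  have hmLx := g.m_add_two_le_Lx
  have h2E : ∀ t, t ≤ E → 2 ^ t ≤ 2 ^ E := fun t ht => Nat.pow_le_pow_right Nat.two_pos ht
  have hwE : 2 ^ w ≤ 2 ^ E := h2E w (by omega)
  -- S ≤ 2^E, N ≤ (2K+1) 2^E
  have hS : g.S ≤ 2 ^ E := h2E _ ((g.B_le_n hK).trans (by omega))
  have hN : g.N ≤ (2 * g.K + 1) * 2 ^ E := by
    have e1 : g.KS ≤ g.K * 2 ^ E := Nat.mul_le_mul_left _ hS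
    have e2 : g.m ≤ 1 * 2 ^ E := by omega
    have e3 : g.K ≤ g.K * 2 ^ E := CliqueRed.le_self_mul_two_pow _ _
    have := CliqueRed.add_le_mul_two_pow (CliqueRed.add_le_mul_two_pow e1 e2) e3
    unfold N; rw [show 2 * g.K + 1 = g.K + 1 + g.K by ring]; exact this
  have hNN : g.N * g.N + 2 ≤ K2 * 2 ^ (2 * E) := by
    have hp : 2 ^ (2 * E) = 2 ^ E * 2 ^ E := by rw [← Nat.pow_add]; congr 1; ring
    have h1 : g.N * g.N ≤ (2 * g.K + 1) * (2 * g.K + 1) * 2 ^ (2 * E) := by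
      calc g.N * g.N ≤ ((2 * g.K + 1) * 2 ^ E) * ((2 * g.K + 1) * 2 ^ E) := Nat.mul_le_mul hN hN
        _ = (2 * g.K + 1) * (2 * g.K + 1) * 2 ^ (2 * E) := by rw [hp]; ring
    exact CliqueRed.add_le_mul_two_pow h1 (by have := Nat.one_le_two_pow (n := 2 * E); omega)
  -- σ, ws
  have hσ : Nat.size (g.N * g.N + 1) ≤ sK + 2 * E := by
    have := Nat.size_le_size (show g.N * g.N + 1 ≤ K2 * 2 ^ (2 * E) by omega)
    rwa [← Nat.shiftLeft_eq, Nat.size_shiftLeft (by positivity)] at this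
  have hws : g.ws ≤ g.kM * sK + 2 * g.kM * E := by
    have : g.ws ≤ g.kM * (sK + 2 * E) := Nat.mul_le_mul_left _ hσ
    have e : g.kM * (sK + 2 * E) = g.kM * sK + 2 * g.kM * E := by ring
    omega
  -- the exponent
  set F := g.ws + 2 * E with hF
  have h2F : ∀ t, t ≤ F → 2 ^ t ≤ 2 ^ F := fun t ht => Nat.pow_le_pow_right Nat.two_pos ht
  have hV : g.V ≤ 2 ^ g.ws + g.cM + K2 * 2 ^ (2 * E) := by
    unfold V Pw; have := Nat.one_le_two_pow (n := g.ws); omega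
  have hBvle : g.Bv ≤ 103 * 2 ^ F := by
    have e1 : 2 * g.Lx ≤ 2 * 2 ^ F := by have := h2F w (by omega); omega
    have e2 : 101 ≤ 101 * 2 ^ F := CliqueRed.le_self_mul_two_pow _ _
    have : g.Bv = 2 * g.Lx + 101 := by rw [← hBv]; unfold X; ring
    rw [this, show (103 : ℕ) = 2 + 101 by norm_num]
    exact CliqueRed.add_le_mul_two_pow e1 e2
  have hVle : 2 * g.V + 2 ≤ (2 * K2 + 2 * g.cM + 4) * 2 ^ F := by
    have e1 : 2 * 2 ^ g.ws ≤ 2 * 2 ^ F := Nat.mul_le_mul_left _ (h2F _ (by omega))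
    have e2 : 2 * g.cM ≤ 2 * g.cM * 2 ^ F := CliqueRed.le_self_mul_two_pow _ _
    have e3 : 2 * (K2 * 2 ^ (2 * E)) ≤ 2 * K2 * 2 ^ F := by
      rw [Nat.mul_assoc]
      exact Nat.mul_le_mul_left _ (Nat.mul_le_mul_left _ (h2F _ (by omega)))
    have e4 : 2 ≤ 2 * 2 ^ F := CliqueRed.le_self_mul_two_pow _ _
    have h := CliqueRed.add_le_mul_two_pow (CliqueRed.add_le_mul_two_pow
      (CliqueRed.add_le_mul_two_pow e1 e2) e3) e4
    rw [show 2 + 2 * g.cM + 2 * K2 + 2 = 2 * K2 + 2 * g.cM + 4 by ring] at h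
    omega
  have htot : g.Sv + g.V + 1 ≤ 2 ^ (Nat.size A + F) := by
    have h := CliqueRed.add_le_mul_two_pow hBvle hVle
    rw [show 103 + (2 * K2 + 2 * g.cM + 4) = A by rw [hA]; ring] at h
    exact le_trans (by omega) (h.trans (CliqueRed.mul_two_pow_le_two_pow_size_add A F))
  have hnK : n + g.K < 2 ^ (Nat.size A + F) := by
    have e1 : n ≤ 1 * 2 ^ F := by have := h2F w (by omega); omega
    have e2 : g.K ≤ g.K * 2 ^ F := CliqueRed.le_self_mul_two_pow _ _
    have h := CliqueRed.add_le_mul_two_pow e1 e2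
    have hKA : 1 + g.K < A := by rw [hA, hK2]; nlinarith
    calc n + g.K ≤ (1 + g.K) * 2 ^ F := h
      _ < A * 2 ^ F := Nat.mul_lt_mul_of_pos_right hKA (Nat.two_pow_pos _)
      _ ≤ 2 ^ (Nat.size A + F) := CliqueRed.mul_two_pow_le_two_pow_size_add A F
  -- the word size
  set sA := Nat.size A with hsA
  have hkfit : kfit g.K g.kM g.cM = sA + g.kM * sK + 2 * g.kM + 5 := rfl
  have hE1 : 1 ≤ E := by omega
  have hW : sA + F + 1 ≤ kfit g.K g.kM g.cM * E := by
    rw [hkfit, hF]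
    have h1 : (sA + g.kM * sK + 3) ≤ (sA + g.kM * sK + 3) * E := Nat.le_mul_of_pos_right _ hE1
    have h2 : (sA + g.kM * sK + 2 * g.kM + 5) * E =
        (sA + g.kM * sK + 3) * E + 2 * g.kM * E + 2 * E := by ring
    omega
  refine ⟨htot.trans (Nat.pow_le_pow_right Nat.two_pos (by omega)), by omega, ?_,
    lt_of_lt_of_le hnK (Nat.pow_le_pow_right Nat.two_pos (by omega))⟩
  calc w ≤ 1 * E := by omega
    _ ≤ kfit g.K g.kM g.cM * E := Nat.mul_le_mul_right _ (by rw [hkfit]; omega)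

/-! ### The running time -/

/-- `Lx = 2 + m + size ≤ 2 + (k + 1) m` for width `≤ k`. [folklore] -/
theorem Lx_le {k : ℕ} (hw : g.φ.IsWidthLE k) : g.Lx ≤ 2 + (k + 1) * g.m := by
  have hsize : CNF.size g.φ ≤ k * g.φ.length := by
    have key : ∀ ψ : CNF ℕ, ψ.IsWidthLE k → CNF.size ψ ≤ k * ψ.length := by
      intro ψ hψ
      unfold CNF.size
      induction ψ with
      | nil => simp
      | cons c ψ ih =>
        simp only [List.map_cons, List.sum_cons, List.length_cons]
        have h1 := hψ c (by simp)
        have h2 := ih (fun d hd => hψ d (by simp [hd]))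
        nlinarith
    exact key _ hw
  unfold Lx x m; rw [length_encodeCNFWords_eq, CNF.numClauses]
  nlinarith

/-- **The running time of the build**: linear in `Lx` and `N²`. [folklore] -/
theorem Tpre_le (hK : 1 ≤ g.K) (k : ℕ) :
    g.Tpre k ≤ 7 * g.Lx + (18 * k + 32) * (g.N * g.N) + 144 := by
  have hN1 : 1 ≤ g.N := by unfold N; omega
  have hN : g.N = g.KS + g.m + g.K := rfl
  have hσ : Nat.size (g.N * g.N + 1) ≤ g.N * g.N + 1 := CliqueRed.size_le_self _
  have h1 : g.N ≤ g.N * g.N := Nat.le_mul_self _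
  unfold Tpre Trow Tcl
  have h2 : g.Trow k + 2 ≤ (18 * k + 10) * g.N + 18 := by
    unfold Trow Tcl; rw [hN]; nlinarith
  have h3 : g.KS * (g.Trow k + 2) ≤ (18 * k + 10) * (g.N * g.N) + 18 * g.N := by
    have hKS : g.KS ≤ g.N := by omega
    calc g.KS * (g.Trow k + 2) ≤ g.N * ((18 * k + 10) * g.N + 18) := Nat.mul_le_mul hKS h2
      _ = (18 * k + 10) * (g.N * g.N) + 18 * g.N := by ring
  unfold Trow Tcl at h3
  nlinarith [h3, hσ, h1]

/-- The vertex number in real terms: `N ≤ (3K + m) · 2^{n/K}`. [folklore] -/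
theorem N_real_le (hK : 1 ≤ g.K) :
    (g.N : ℝ) ≤ (3 * (g.K : ℝ) + g.m) * (2 : ℝ) ^ ((g.n : ℝ) / g.K) := by
  set X : ℝ := (2 : ℝ) ^ ((g.n : ℝ) / g.K) with hXdef
  have hX1 : 1 ≤ X := Real.one_le_rpow one_le_two (by positivity)
  have hB : g.B ≤ g.n / g.K + 1 := blockLen_le g.n hK
  have hS : (g.S : ℝ) ≤ 2 * X := by
    have h1 : (g.S : ℝ) ≤ ((2 ^ (g.n / g.K + 1) : ℕ) : ℝ) := by
      exact_mod_cast Nat.pow_le_pow_right Nat.two_pos hB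
    have h2 : (((2 : ℕ) ^ (g.n / g.K) : ℕ) : ℝ) ≤ X := by
      rw [Nat.cast_pow, Nat.cast_two, ← Real.rpow_natCast]
      exact Real.rpow_le_rpow_of_exponent_le one_le_two Nat.cast_div_le
    calc (g.S : ℝ) ≤ ((2 ^ (g.n / g.K + 1) : ℕ) : ℝ) := h1
      _ = 2 * (((2 : ℕ) ^ (g.n / g.K) : ℕ) : ℝ) := by push_cast; ring
      _ ≤ 2 * X := by linarith
  have hK0 : (0 : ℝ) ≤ g.K := Nat.cast_nonneg _
  have hm0 : (0 : ℝ) ≤ g.m := Nat.cast_nonneg _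
  have hN : (g.N : ℝ) = g.K * g.S + g.m + g.K := by unfold N KS; push_cast; ring
  rw [hN]
  have e1 : (g.K : ℝ) * g.S ≤ g.K * (2 * X) := mul_le_mul_of_nonneg_left hS hK0
  nlinarith [e1, hX1, hK0, hm0]

/-- `(3K + m)` and the instance are at least `1`; basic positivity. [folklore] -/
theorem one_le_Q (hK : 1 ≤ g.K) : (1 : ℝ) ≤ 3 * (g.K : ℝ) + g.m := by
  have : (1 : ℝ) ≤ g.K := by exact_mod_cast hK
  have : (0 : ℝ) ≤ g.m := Nat.cast_nonneg _
  linarith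

/-- **The emulated run in real terms**: `N^{K-ε} ≤ (3K+m)^K · 2^{(1-ε/K) n}` for `0 < ε ≤ K`.
[folklore] -/
theorem N_rpow_le (hK : 1 ≤ g.K) {ε : ℝ} (hε : 0 < ε) (hεK : ε ≤ g.K) :
    (g.N : ℝ) ^ ((g.K : ℝ) - ε) ≤
      (3 * (g.K : ℝ) + g.m) ^ g.K * (2 : ℝ) ^ ((1 - ε / g.K) * g.n) := by
  set Q : ℝ := 3 * (g.K : ℝ) + g.m with hQ
  set X : ℝ := (2 : ℝ) ^ ((g.n : ℝ) / g.K) with hXdef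
  have hQ1 : 1 ≤ Q := g.one_le_Q hK
  have hX0 : 0 ≤ X := by positivity
  have hKpos : (0 : ℝ) < g.K := by exact_mod_cast hK
  have hexp : 0 ≤ (g.K : ℝ) - ε := by linarith
  have hN := g.N_real_le hK
  calc (g.N : ℝ) ^ ((g.K : ℝ) - ε) ≤ (Q * X) ^ ((g.K : ℝ) - ε) :=
        Real.rpow_le_rpow (Nat.cast_nonneg _) hN hexp
    _ = Q ^ ((g.K : ℝ) - ε) * X ^ ((g.K : ℝ) - ε) := Real.mul_rpow (by linarith) hX0
    _ ≤ Q ^ (g.K : ℝ) * X ^ ((g.K : ℝ) - ε) := by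
        apply mul_le_mul_of_nonneg_right _ (Real.rpow_nonneg hX0 _)
        exact Real.rpow_le_rpow_of_exponent_le hQ1 (by linarith)
    _ = Q ^ g.K * (2 : ℝ) ^ ((1 - ε / g.K) * g.n) := by
        rw [Real.rpow_natCast, hXdef, ← Real.rpow_mul (by norm_num)]
        congr 2
        field_simp

/-- **The build in real terms**: `N² ≤ (3K+m)^K · 2^{(1-ε/K) n}` for `K ≥ 3`, `ε ≤ 1`. [folklore] -/
theorem N_sq_le (hK : 3 ≤ g.K) {ε : ℝ} (hε1 : ε ≤ 1) :
    (g.N : ℝ) ^ 2 ≤ (3 * (g.K : ℝ) + g.m) ^ g.K * (2 : ℝ) ^ ((1 - ε / g.K) * g.n) := by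
  set Q : ℝ := 3 * (g.K : ℝ) + g.m with hQ
  set X : ℝ := (2 : ℝ) ^ ((g.n : ℝ) / g.K) with hXdef
  have hQ1 : 1 ≤ Q := g.one_le_Q (by omega)
  have hX0 : 0 ≤ X := by positivity
  have hKpos : (0 : ℝ) < g.K := by exact_mod_cast (show 0 < g.K by omega)
  have hK3 : (3 : ℝ) ≤ g.K := by exact_mod_cast hK
  have hn0 : (0 : ℝ) ≤ g.n := Nat.cast_nonneg _
  have hN := g.N_real_le (by omega)
  have hN0 : (0 : ℝ) ≤ g.N := Nat.cast_nonneg _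
  have h1 : (g.N : ℝ) ^ 2 ≤ (Q * X) ^ 2 := pow_le_pow_left₀ hN0 hN 2
  have h2 : X ^ 2 = (2 : ℝ) ^ (2 * ((g.n : ℝ) / g.K)) := by
    rw [hXdef, ← Real.rpow_natCast, ← Real.rpow_mul (by norm_num)]; ring_nf
  have h3 : (2 : ℝ) ^ (2 * ((g.n : ℝ) / g.K)) ≤ (2 : ℝ) ^ ((1 - ε / g.K) * g.n) := by
    apply Real.rpow_le_rpow_of_exponent_le one_le_two
    rw [show 2 * ((g.n : ℝ) / g.K) = (2 / g.K) * g.n by ring]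
    apply mul_le_mul_of_nonneg_right _ hn0
    rw [div_le_iff₀ hKpos, sub_mul, div_mul_cancel₀ _ hKpos.ne']
    linarith
  have h4 : Q ^ 2 ≤ Q ^ g.K := pow_le_pow_right₀ hQ1 (by omega)
  calc (g.N : ℝ) ^ 2 ≤ (Q * X) ^ 2 := h1
    _ = Q ^ 2 * X ^ 2 := mul_pow _ _ _
    _ ≤ Q ^ g.K * (2 : ℝ) ^ ((1 - ε / g.K) * g.n) := by
        rw [h2]; exact mul_le_mul h4 h3 (by positivity) (by positivity)

/-- `(3K + m)^K` is polynomial in `n` on `k`-CNFs without repeated clauses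
(`m ≤ (2(n+1))^{k+1}`). [folklore] -/
theorem Q_pow_le {k : ℕ} (hm : g.m ≤ (2 * (g.n + 1)) ^ (k + 1)) :
    (3 * (g.K : ℝ) + g.m) ^ g.K ≤
      (3 * (g.K : ℝ) + 2 ^ (k + 1)) ^ g.K * ((g.n : ℝ) + 1) ^ ((k + 1) * g.K) := by
  have hm' : (g.m : ℝ) ≤ 2 ^ (k + 1) * ((g.n : ℝ) + 1) ^ (k + 1) := by
    have : ((g.m : ℕ) : ℝ) ≤ (((2 * (g.n + 1)) ^ (k + 1) : ℕ) : ℝ) := by exact_mod_cast hm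
    simpa [mul_pow] using this
  have hP1 : (1 : ℝ) ≤ ((g.n : ℝ) + 1) ^ (k + 1) := one_le_pow₀ (by linarith [Nat.cast_nonneg (α := ℝ) g.n])
  have hK0 : (0 : ℝ) ≤ 3 * g.K := by positivity
  have hQ : 3 * (g.K : ℝ) + g.m ≤ (3 * (g.K : ℝ) + 2 ^ (k + 1)) * ((g.n : ℝ) + 1) ^ (k + 1) := by
    nlinarith
  calc (3 * (g.K : ℝ) + g.m) ^ g.K ≤ ((3 * (g.K : ℝ) + 2 ^ (k + 1)) * ((g.n : ℝ) + 1) ^ (k + 1)) ^ g.K :=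
        pow_le_pow_left₀ (by positivity) hQ _
    _ = (3 * (g.K : ℝ) + 2 ^ (k + 1)) ^ g.K * ((g.n : ℝ) + 1) ^ ((k + 1) * g.K) := by
        rw [mul_pow, ← pow_mul]

end Params

end DomSetRed

end Literature.Computability.FineGrained
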